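import Mathlib.MeasureTheory.Constructions.HaarToSphere
import Mathlib.Analysis.SpecialFunctions.ImproperIntegrals
import Mathlib.Analysis.SpecialFunctions.Integrals.Basic
import Mathlib.MeasureTheory.Integral.MeanInequalities
import Literature.Analysis.FluidPDE.TaoEnergyLocalisationProofs
import Literature.Analysis.FluidPDE.NormalisedPressureProofs
import HarnessLib

/-!
# Tao (2011/2013), Lemma 8.1 — layer 3: the pressure term `X₅`

Third layer of the discharge of `NS.tao_finite_energy_smooth_energy_bound` (Tao 2011 =
arXiv:1108.1165, **Lemma 8.1**: energy inequality for finite energy smooth solutions on `ℝ³`).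
Layer 1 (`TaoEnergyLocalisation`) reduced the fact to the localised energy inequality (65);
layer 2 (`TaoEnergyLocalisationProofs`) proved (65) from Tao's pressure normalisation
(`NS.tao_pressure_normalisation`, Lemma 4.1 (i)) and the estimate of the pressure term
`NS.tao2011_pressureTerm_estimate` (vendored there as a named fact). This file PROVES that
estimate from the two classical singular-integral inputs it rests on:

  `tao2011_pressureTerm_estimate_of_riesz :
     hasPressurePV_of_contDiff → stein1970_normalisedPressure_eLpNorm_le →
       tao2011_pressureTerm_estimate`,

and hence (`tao_finite_energy_smooth_energy_bound_of_riesz`)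

  `tao_pressure_normalisation → hasPressurePV_of_contDiff →
     stein1970_normalisedPressure_eLpNorm_le → tao_finite_energy_smooth_energy_bound`.

* `NS.hasPressurePV_of_contDiff` (tree, `NormalisedPressureProofs`, named fact; Stein 1970
  Ch. III §1): the principal values defining `p̃ = NS.normalisedPressure` exist for `C¹ ∩ L²`
  fields.
* `NS.stein1970_normalisedPressure_eLpNorm_le` (**named fact vendored here**, nothing asserted;
  Stein 1970, Ch. II §4.2 Theorem 3): `‖p̃[w]‖_{L²} ≤ C ‖|w|²‖_{L²}` for `w ∈ C^∞_c(ℝ³; ℝ³)` —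
  Tao's "the singular integral `Δ⁻¹∇²` is bounded on `L²`".

## The argument (Tao 2011, §8, proof of Lemma 8.1, between (64) and (65), with the commutator step repaired)

With `θ = taoCutoff R r` (`0 < r < R/2`, `‖Dθ‖ ≤ C₁/r`), Tao's `η = θ²`, the pressure pairing of
the localised energy balance is `X₅ = ∫ p̃[v] D(θ⁸)(v) = ∫ (θ⁶ p̃[v]) g`, `g = 8 θ Dθ(v)`,
`|g| ≤ 8(C₁/r) θ|v|`. Moving `θ⁶ = η³` through the singular integral
(`K(z)(θ³(y)a) = θ⁶(y) K(z)(a)`; the local terms `-|·|²/3` cancel),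

  `θ⁶(x) p̃[v](x) = p̃[θ³v](x) + ∫ k(x,y) dy`,  `k(x,y) = (θ⁶(x) - θ⁶(y)) K(x-y)(v(y))`

(`commutator_eq_integral`; `k(x, ·)` is absolutely integrable, the principal values exist by
`hasPressurePV_of_contDiff`, dominated convergence identifies the limit).
* Direct term `X₅,₁ = ∫ p̃[θ³v] g` (`direct_pairing_le`): Cauchy–Schwarz, the `L²` bound,
  `‖θ⁶|v|²‖_{L²} ≤ ‖v‖^{1/2}_{L²} ‖θ⁴v‖^{3/2}_{L⁶}` (Cauchy–Schwarz) and the Sobolev step of layer 2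
  (`‖θ⁴v‖_{L⁶} ≤ K √(2X₁ + 32(C₁/r)²A²)`): `|X₅,₁| ≤ 8 C_R (C₁/r) A^{3/2} ‖θ⁴v‖^{3/2}_{L⁶}` — Tao's
  `A^{3/2} r⁻¹ X₁^{3/4} + A³ r^{-5/2}`.
* Commutator term `X₅,₂ = ∫ (∫k) g` (`commutator_pairing_le`). The printed bound
  "`‖[Δ⁻¹∇², η³]f‖_{L²} ≲ r^{-3/2}‖f‖_{L¹}`" is not correct as an operator bound (the kernel is
  `≍ r⁻¹|x-y|⁻²` near the diagonal, not square integrable in `ℝ³`); instead we use the pointwise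
  majorant (`abs_commKernel_le`, from `|K(z)(a)| ≤ |a|²/(2π|z|³)` and, on `|x-y| < r`,
  `|θ⁶(x) - θ⁶(y)| ≤ 6θ⁵(x)|θ(x)-θ(y)| + 15(θ(x)-θ(y))²`, `|θ(x) - θ(y)| ≤ (C₁/r)|x-y|`):
  `|k(x,y)| ≤ (|v(y)|²/2π) (1_{|x-y|≥r}|x-y|⁻³ + 6(C₁/r)θ⁵(x) 1_{|x-y|<r}|x-y|⁻² + 15(C₁/r)² 1_{|x-y|<r}|x-y|⁻¹)`.
  Against the weight `θ|v|(x)` and `|v(y)|² ∈ L¹`, by Tonelli and Hölder in `x` for fixed `y`: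
  far kernel in `L²` (`‖·‖_{L²} = √(4π/(3r³))`) against `θv ∈ L²`; first near kernel in `L^{6/5}`
  (`‖·‖ = ((20π/3) r^{3/5})^{5/6}`) against `θ⁶v ∈ L⁶` (Sobolev); second near kernel in `L²`
  (`‖·‖ = √(4πr)`) against `θv ∈ L²`. Result:
  `|X₅,₂| ≤ 8(C₁/r)(A³/(r√r) + 41 C₁ A² ‖θ⁶v‖_{L⁶} √r/r + 15 C₁² A³ √r/r²)` — Tao's `A³ r^{-5/2}`
  plus `A² r^{-3/2} ‖θ⁴ v‖_{L⁶}`.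
* Absorption (`pressure_assembly_arith`): Young `M√(D³) ≤ ηD² + M⁴/η³`, `a√X ≤ (ε/2)X + a²/(2ε)`,
  and `A³/r^{5/2}`, `A⁴/(εr³)` are geometric means of `εA²/r²`, `A⁶/(ε³r⁴)`; constant
  `pressureConst C₁ K C_R`.

## Contents

* §Kernel/§Radial/§Kernels/§KernelNorms: `|K(z)(a)| ≤ |a|²/(2π|z|³)`, measurability, polar
  coordinates on `ℝ³`, the three radial kernels and their Lebesgue norms.
* §Abstract: Hölder against a translated kernel, Tonelli with a uniform inner bound (`ℝ≥0∞`).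
* §CutoffPieces/§Commutator: the commutator kernel, its majorant, absolute integrability, the
  commutator representation `commutator_eq_integral`, measurability in `x`.
* §CommutatorBound: `lintegral_weight_mul_commKernel_le` and its real form, `commutator_pairing_le`.
* `stein1970_normalisedPressure_eLpNorm_le` (named fact); §DirectTerm: `direct_pairing_le`.
* §Arith: the bookkeeping; §Assembly: `tao2011_pressureTerm_estimate_of_riesz`,
  `tao_finite_energy_smooth_energy_bound_of_riesz`.

## Mathlib / tree search

`MeasureTheory.integral_fun_norm_addHaar` (polar coordinates, used), `integral_Ioi_rpow_of_lt`,
`integral_rpow` (used), `ENNReal.lintegral_mul_le_Lp_mul_Lq` (Hölder, used),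
`lintegral_sub_right_eq_self`, `lintegral_lintegral_swap` (used), `Measurable.lintegral_prod_right'`,
`StronglyMeasurable.integral_prod_right` (used), `MemLp.integrable_mul`,
`Convex.norm_image_sub_le_of_norm_fderiv_le` (used); no `rieszTransform`/`singularIntegral`/
Calderón–Zygmund theory in Mathlib at this pin (hence the named fact). Tree: `NS.pressureKernel`,
`NS.truncatedPressureIntegral`, `NS.HasPressurePV`, `NS.normalisedPressure`,
`NS.hasPressurePV_of_contDiff` (`NormalisedPressure(Proofs)`), layer-2 lemmas
`exists_norm_fderiv_taoCutoff_le`, `integral_norm_taoCutoff_pow_four_smul_pow_six_le`,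
`integral_mul_le_sqrt_mul_sqrt`, `mul_sqrt_pow_three_le`, `eLpNorm_natCast_eq_ofReal`.

## References

* T. Tao, *Localisation and compactness properties of the Navier–Stokes global regularity
  problem*, Anal. PDE 6 (2013) 25–107 = arXiv:1108.1165 (`Tao2011`): §8, Lemma 8.1 and its
  proof, (61)–(65) (arXiv text pp. 24–25), estimate of `X₅ = X₅,₁ + X₅,₂`.
* E. M. Stein, *Singular integrals and differentiability properties of functions*, Princeton
  Math. Series 30 (1970) (`Stein1971`): Ch. II §4.2 Theorem 3 and §4.5 Theorem 4 (pp. 36, 39 of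
  the held scan), Ch. III §1 (Riesz transforms, (5) p. 51 of the held scan).
-/

noncomputable section

open MeasureTheory Set Filter Topology Function Metric
open scoped ENNReal NNReal RealInnerProductSpace ContDiff

namespace Literature.Analysis.FluidPDE

/-- Local notation for physical space `ℝ³ = EuclideanSpace ℝ (Fin 3)`. -/
local notation "ℝ³" => EuclideanSpace ℝ (Fin 3)

/-! ## The pressure kernel on `ℝ³`: size and measurability -/

section Kernel

/-- **Size of the pressure kernel:** `|K(z)(a)| ≤ |a|²/(2π|z|³)` on `ℝ³`
(`|3⟨z,a⟩² - |a|²|z|²| ≤ 2|a|²|z|²`). At `z = 0` both sides vanish. [folklore] -/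
theorem abs_pressureKernel_le (z a : ℝ³) :
    |pressureKernel z a| ≤ ‖a‖ ^ 2 / (2 * Real.pi * ‖z‖ ^ 3) := by
  rw [pressureKernel_eq_fin3]
  rcases eq_or_ne z 0 with rfl | hz
  · simp
  have hz' : 0 < ‖z‖ := norm_pos_iff.2 hz
  rw [abs_div, abs_of_pos (by positivity : 0 < 4 * Real.pi * ‖z‖ ^ 5),
    div_le_div_iff₀ (by positivity) (by positivity)]
  have h1 : ⟪z, a⟫ ^ 2 ≤ ‖z‖ ^ 2 * ‖a‖ ^ 2 := by
    have h := abs_real_inner_le_norm z a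
    have h0 : 0 ≤ |⟪z, a⟫| := abs_nonneg _
    calc ⟪z, a⟫ ^ 2 = |⟪z, a⟫| ^ 2 := (sq_abs _).symm
      _ ≤ (‖z‖ * ‖a‖) ^ 2 := pow_le_pow_left₀ h0 h 2
      _ = ‖z‖ ^ 2 * ‖a‖ ^ 2 := by ring
  have h2 : |3 * ⟪z, a⟫ ^ 2 - ‖a‖ ^ 2 * ‖z‖ ^ 2| ≤ 2 * ‖a‖ ^ 2 * ‖z‖ ^ 2 := by
    rw [abs_le]
    constructor <;> nlinarith [sq_nonneg ⟪z, a⟫]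
  calc |3 * ⟪z, a⟫ ^ 2 - ‖a‖ ^ 2 * ‖z‖ ^ 2| * (2 * Real.pi * ‖z‖ ^ 3)
      ≤ 2 * ‖a‖ ^ 2 * ‖z‖ ^ 2 * (2 * Real.pi * ‖z‖ ^ 3) := by gcongr
    _ = ‖a‖ ^ 2 * (4 * Real.pi * ‖z‖ ^ 5) := by ring

/-- The pressure kernel is jointly measurable in `(z, a)` (a quotient of continuous functions;
Lean's `x / 0 = 0` on the diagonal). [folklore] -/
theorem measurable_pressureKernel :
    Measurable fun p : ℝ³ × ℝ³ => pressureKernel p.1 p.2 := by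
  have h1 : Continuous fun p : ℝ³ × ℝ³ =>
      (Module.finrank ℝ ℝ³ : ℝ) * ⟪p.1, p.2⟫ ^ 2 - ‖p.2‖ ^ 2 * ‖p.1‖ ^ 2 := by
    fun_prop
  have h2 : Continuous fun p : ℝ³ × ℝ³ =>
      unitSphereArea ℝ³ * ‖p.1‖ ^ (Module.finrank ℝ ℝ³ + 2) := by
    fun_prop
  have h3 : Measurable fun p : ℝ³ × ℝ³ =>
      ((Module.finrank ℝ ℝ³ : ℝ) * ⟪p.1, p.2⟫ ^ 2 - ‖p.2‖ ^ 2 * ‖p.1‖ ^ 2) /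
        (unitSphereArea ℝ³ * ‖p.1‖ ^ (Module.finrank ℝ ℝ³ + 2)) :=
    h1.measurable.div h2.measurable
  exact h3

end Kernel

/-! ## Radial integrals in `ℝ³` -/

section Radial

/-- `vol(B₁) = 4π/3` in `ℝ³`, real form. [folklore] -/
theorem volume_real_ball_zero_one : (volume : Measure ℝ³).real (ball 0 1) = 4 * Real.pi / 3 := by
  rw [Measure.real, EuclideanSpace.volume_ball_fin_three]
  rw [ENNReal.toReal_mul, ENNReal.ofReal_one, one_pow, ENNReal.toReal_one,
    ENNReal.toReal_ofReal (by positivity)]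
  ring

/-- **Polar coordinates in `ℝ³`:** `∫ f(|x|) dx = 4π ∫₀^∞ ρ² f(ρ) dρ` (Mathlib's
`integral_fun_norm_addHaar`). [folklore] -/
theorem integral_fun_norm_eq (f : ℝ → ℝ) :
    ∫ x : ℝ³, f ‖x‖ = 4 * Real.pi * ∫ y in Ioi (0 : ℝ), y ^ 2 * f y := by
  rw [integral_fun_norm_addHaar (volume : Measure ℝ³) f, finrank_euclideanSpace_fin,
    volume_real_ball_zero_one]
  simp only [smul_eq_mul, nsmul_eq_mul, Nat.cast_ofNat]
  norm_num
  ring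

/-- Integrability in polar coordinates: `x ↦ f(|x|)` is integrable on `ℝ³` iff `ρ ↦ ρ² f(ρ)` is
integrable on `(0, ∞)`. [folklore] -/
theorem integrable_fun_norm_iff (f : ℝ → ℝ) :
    Integrable (fun x : ℝ³ => f ‖x‖) ↔ IntegrableOn (fun y : ℝ => y ^ 2 * f y) (Ioi 0) := by
  rw [integrable_fun_norm_addHaar (volume : Measure ℝ³) (f := f), finrank_euclideanSpace_fin]
  simp only [smul_eq_mul]

/-- `(0, ∞) ∩ [r, ∞) = [r, ∞)` for `r > 0`. [folklore] -/
theorem Ioi_zero_inter_Ici {r : ℝ} (hr : 0 < r) : Ioi (0 : ℝ) ∩ Ici r = Ici r := by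
  ext x
  simp only [mem_inter_iff, mem_Ioi, mem_Ici]
  exact ⟨fun h => h.2, fun h => ⟨hr.trans_le h, h⟩⟩

/-- `(0, ∞) ∩ (0, r) = (0, r)`. [folklore] -/
theorem Ioi_zero_inter_Ioo (r : ℝ) : Ioi (0 : ℝ) ∩ Ioo 0 r = Ioo 0 r := by
  ext x
  simp only [mem_inter_iff, mem_Ioi, mem_Ioo]
  tauto

end Radial

/-! ## The three radial kernels of the commutator estimate

Far kernel `1_{|z| ≥ r}|z|⁻³` (paired in `L² × L²`), near kernels `1_{|z| < r}|z|⁻²` (paired in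
`L⁶ × L^{6/5}`) and `1_{|z| < r}|z|⁻¹` (paired in `L² × L²`); we compute
`∫ (1_{|z|≥r}|z|⁻³)² = 4π/(3r³)`, `∫ (1_{|z|<r}|z|⁻²)^{6/5} = (20π/3) r^{3/5}`, `∫ (1_{|z|<r}|z|⁻¹)² = 4πr`. -/

section Kernels

/-- Radial profile of the far kernel, `1_{r ≤ ρ} ρ⁻³`. [folklore] -/
def farProfile (r ρ : ℝ) : ℝ := if r ≤ ρ then (ρ ^ 3)⁻¹ else 0

/-- Radial profile of the first near kernel, `1_{ρ < r} ρ⁻²`. [folklore] -/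
def nearProfile₂ (r ρ : ℝ) : ℝ := if ρ < r then (ρ ^ 2)⁻¹ else 0

/-- Radial profile of the second near kernel, `1_{ρ < r} ρ⁻¹`. [folklore] -/
def nearProfile₁ (r ρ : ℝ) : ℝ := if ρ < r then ρ⁻¹ else 0

variable {r : ℝ}

/-- `0 ≤ 1_{r ≤ ρ} ρ⁻³` for `ρ ≥ 0`. [folklore] -/
theorem farProfile_nonneg (r : ℝ) {ρ : ℝ} (hρ : 0 ≤ ρ) : 0 ≤ farProfile r ρ := by
  unfold farProfile
  split_ifs
  · positivity
  · exact le_rfl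

/-- `0 ≤ 1_{ρ < r} ρ⁻²`. [folklore] -/
theorem nearProfile₂_nonneg (r ρ : ℝ) : 0 ≤ nearProfile₂ r ρ := by
  unfold nearProfile₂
  split_ifs
  · positivity
  · exact le_rfl

/-- `0 ≤ 1_{ρ < r} ρ⁻¹` for `ρ ≥ 0`. [folklore] -/
theorem nearProfile₁_nonneg (r : ℝ) {ρ : ℝ} (hρ : 0 ≤ ρ) : 0 ≤ nearProfile₁ r ρ := by
  unfold nearProfile₁
  split_ifs
  · positivity
  · exact le_rfl

/-- Measurability of the far profile. [folklore] -/
theorem measurable_farProfile (r : ℝ) : Measurable (farProfile r) :=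
  Measurable.ite measurableSet_Ici ((measurable_id.pow_const 3).inv) measurable_const

/-- Measurability of the first near profile. [folklore] -/
theorem measurable_nearProfile₂ (r : ℝ) : Measurable (nearProfile₂ r) :=
  Measurable.ite measurableSet_Iio ((measurable_id.pow_const 2).inv) measurable_const

/-- Measurability of the second near profile. [folklore] -/
theorem measurable_nearProfile₁ (r : ℝ) : Measurable (nearProfile₁ r) :=
  Measurable.ite measurableSet_Iio measurable_id.inv measurable_const

/-- Polar form of the squared far kernel: `ρ² (1_{r≤ρ}ρ⁻³)² = 1_{[r,∞)}(ρ) ρ⁻⁴` for `ρ > 0`. [folklore] -/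
theorem sq_mul_farProfile_sq (r : ℝ) {ρ : ℝ} (hρ : 0 < ρ) :
    ρ ^ 2 * farProfile r ρ ^ 2 = (Ici r).indicator (fun ρ : ℝ => ρ ^ (-4 : ℝ)) ρ := by
  unfold farProfile
  by_cases h : r ≤ ρ
  · rw [if_pos h, indicator_of_mem (mem_Ici.2 h)]
    rw [show (-4 : ℝ) = -((4 : ℕ) : ℝ) by norm_num, Real.rpow_neg hρ.le, Real.rpow_natCast]
    field_simp
  · rw [if_neg h, indicator_of_notMem (fun h' => h (mem_Ici.1 h'))]
    ring

/-- **`∫_{ℝ³} (1_{|z|≥r}|z|⁻³)² dz = 4π/(3r³)`**, with integrability. [folklore] -/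
theorem integral_farProfile_norm_sq (hr : 0 < r) :
    Integrable (fun z : ℝ³ => farProfile r ‖z‖ ^ 2) ∧
      ∫ z : ℝ³, farProfile r ‖z‖ ^ 2 = 4 * Real.pi / (3 * r ^ 3) := by
  have hg : IntegrableOn (fun ρ : ℝ => ρ ^ (-4 : ℝ)) (Ici r) := by
    rw [integrableOn_Ici_iff_integrableOn_Ioi]
    exact integrableOn_Ioi_rpow_of_lt (by norm_num) hr
  have hind : Integrable ((Ici r).indicator fun ρ : ℝ => ρ ^ (-4 : ℝ)) :=
    (integrable_indicator_iff measurableSet_Ici).2 hg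
  have hI : IntegrableOn (fun ρ : ℝ => ρ ^ 2 * farProfile r ρ ^ 2) (Ioi 0) :=
    hind.integrableOn.congr_fun (fun ρ hρ => (sq_mul_farProfile_sq r hρ).symm) measurableSet_Ioi
  refine ⟨(integrable_fun_norm_iff (fun ρ => farProfile r ρ ^ 2)).2 hI, ?_⟩
  rw [integral_fun_norm_eq (fun ρ => farProfile r ρ ^ 2),
    setIntegral_congr_fun measurableSet_Ioi (fun ρ hρ => sq_mul_farProfile_sq r hρ),
    setIntegral_indicator measurableSet_Ici, Ioi_zero_inter_Ici hr, integral_Ici_eq_integral_Ioi,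
    integral_Ioi_rpow_of_lt (by norm_num) hr]
  rw [show (-4 : ℝ) + 1 = -((3 : ℕ) : ℝ) by norm_num, Real.rpow_neg hr.le, Real.rpow_natCast]
  field_simp
  ring

/-- Polar form of the `6/5`-th power of the first near kernel:
`ρ² (1_{ρ<r}ρ⁻²)^{6/5} = 1_{(0,r)}(ρ) ρ^{-2/5}` for `ρ > 0`. [folklore] -/
theorem sq_mul_nearProfile₂_rpow (r : ℝ) {ρ : ℝ} (hρ : 0 < ρ) :
    ρ ^ 2 * nearProfile₂ r ρ ^ (6 / 5 : ℝ) = (Ioo 0 r).indicator (fun ρ : ℝ => ρ ^ (-(2 / 5) : ℝ)) ρ := by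
  unfold nearProfile₂
  by_cases h : ρ < r
  · rw [if_pos h, indicator_of_mem (mem_Ioo.2 ⟨hρ, h⟩)]
    rw [Real.inv_rpow (sq_nonneg ρ), ← Real.rpow_natCast ρ 2, ← Real.rpow_mul hρ.le,
      ← Real.rpow_neg hρ.le, ← Real.rpow_add hρ]
    norm_num
  · rw [if_neg h, indicator_of_notMem (fun h' => h (mem_Ioo.1 h').2),
      Real.zero_rpow (by norm_num), mul_zero]

/-- **`∫_{ℝ³} (1_{|z|<r}|z|⁻²)^{6/5} dz = (20π/3) r^{3/5}`**, with integrability. [folklore] -/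
theorem integral_nearProfile₂_norm_rpow (hr : 0 < r) :
    Integrable (fun z : ℝ³ => nearProfile₂ r ‖z‖ ^ (6 / 5 : ℝ)) ∧
      ∫ z : ℝ³, nearProfile₂ r ‖z‖ ^ (6 / 5 : ℝ) = 20 * Real.pi / 3 * r ^ (3 / 5 : ℝ) := by
  have hii : IntervalIntegrable (fun ρ : ℝ => ρ ^ (-(2 / 5) : ℝ)) volume 0 r :=
    intervalIntegral.intervalIntegrable_rpow' (by norm_num)
  have hg : IntegrableOn (fun ρ : ℝ => ρ ^ (-(2 / 5) : ℝ)) (Ioo 0 r) :=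
    hii.1.mono_set Ioo_subset_Ioc_self
  have hind : Integrable ((Ioo 0 r).indicator fun ρ : ℝ => ρ ^ (-(2 / 5) : ℝ)) :=
    (integrable_indicator_iff measurableSet_Ioo).2 hg
  have hI : IntegrableOn (fun ρ : ℝ => ρ ^ 2 * nearProfile₂ r ρ ^ (6 / 5 : ℝ)) (Ioi 0) :=
    hind.integrableOn.congr_fun (fun ρ hρ => (sq_mul_nearProfile₂_rpow r hρ).symm)
      measurableSet_Ioi
  refine ⟨(integrable_fun_norm_iff (fun ρ => nearProfile₂ r ρ ^ (6 / 5 : ℝ))).2 hI, ?_⟩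
  rw [integral_fun_norm_eq (fun ρ => nearProfile₂ r ρ ^ (6 / 5 : ℝ)),
    setIntegral_congr_fun measurableSet_Ioi (fun ρ hρ => sq_mul_nearProfile₂_rpow r hρ),
    setIntegral_indicator measurableSet_Ioo, Ioi_zero_inter_Ioo, ← integral_Ioc_eq_integral_Ioo,
    ← intervalIntegral.integral_of_le hr.le, integral_rpow (Or.inl (by norm_num))]
  rw [Real.zero_rpow (by norm_num)]
  norm_num
  ring

/-- Polar form of the squared second near kernel: `ρ² (1_{ρ<r}ρ⁻¹)² = 1_{(0,r)}(ρ)` for `ρ > 0`.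
[folklore] -/
theorem sq_mul_nearProfile₁_sq (r : ℝ) {ρ : ℝ} (hρ : 0 < ρ) :
    ρ ^ 2 * nearProfile₁ r ρ ^ 2 = (Ioo 0 r).indicator (fun _ : ℝ => (1 : ℝ)) ρ := by
  unfold nearProfile₁
  by_cases h : ρ < r
  · rw [if_pos h, indicator_of_mem (mem_Ioo.2 ⟨hρ, h⟩)]
    field_simp
  · rw [if_neg h, indicator_of_notMem (fun h' => h (mem_Ioo.1 h').2)]
    ring

/-- **`∫_{ℝ³} (1_{|z|<r}|z|⁻¹)² dz = 4πr`**, with integrability. [folklore] -/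
theorem integral_nearProfile₁_norm_sq (hr : 0 < r) :
    Integrable (fun z : ℝ³ => nearProfile₁ r ‖z‖ ^ 2) ∧
      ∫ z : ℝ³, nearProfile₁ r ‖z‖ ^ 2 = 4 * Real.pi * r := by
  have hvol : volume (Ioo (0 : ℝ) r) ≠ ⊤ := by
    rw [Real.volume_Ioo]
    exact ENNReal.ofReal_ne_top
  have hg : IntegrableOn (fun _ : ℝ => (1 : ℝ)) (Ioo 0 r) := integrableOn_const (hs := hvol)
  have hind : Integrable ((Ioo 0 r).indicator fun _ : ℝ => (1 : ℝ)) :=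
    (integrable_indicator_iff measurableSet_Ioo).2 hg
  have hI : IntegrableOn (fun ρ : ℝ => ρ ^ 2 * nearProfile₁ r ρ ^ 2) (Ioi 0) :=
    hind.integrableOn.congr_fun (fun ρ hρ => (sq_mul_nearProfile₁_sq r hρ).symm) measurableSet_Ioi
  refine ⟨(integrable_fun_norm_iff (fun ρ => nearProfile₁ r ρ ^ 2)).2 hI, ?_⟩
  rw [integral_fun_norm_eq (fun ρ => nearProfile₁ r ρ ^ 2),
    setIntegral_congr_fun measurableSet_Ioi (fun ρ hρ => sq_mul_nearProfile₁_sq r hρ),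
    setIntegral_indicator measurableSet_Ioo, Ioi_zero_inter_Ioo, setIntegral_const,
    Real.volume_real_Ioo_of_le hr.le, smul_eq_mul]
  ring

end Kernels

/-! ## Two abstract integral inequalities: Hölder against a translated kernel, and Tonelli -/

section Abstract

/-- **Hölder against a translated kernel.** For `p, q` conjugate exponents and nonnegative
`F, k : ℝ³ → [0, ∞]`, `∫ F(x) k(x - y) dx ≤ ‖F‖_{L^p} ‖k‖_{L^q}` for every `y` (Hölder's inequality
and the translation invariance of Lebesgue measure). [folklore] -/
theorem lintegral_mul_shift_le {p q : ℝ} (hpq : p.HolderConjugate q) {F k : ℝ³ → ℝ≥0∞}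
    (hF : Measurable F) (hk : Measurable k) (y : ℝ³) :
    ∫⁻ x, F x * k (x - y) ≤ (∫⁻ x, F x ^ p) ^ (1 / p) * (∫⁻ z, k z ^ q) ^ (1 / q) := by
  have hk' : Measurable fun x : ℝ³ => k (x - y) := hk.comp (measurable_id.sub_const y)
  have h := ENNReal.lintegral_mul_le_Lp_mul_Lq volume hpq hF.aemeasurable hk'.aemeasurable
  have htr : ∫⁻ x, (fun x : ℝ³ => k (x - y)) x ^ q = ∫⁻ z, k z ^ q :=
    lintegral_sub_right_eq_self (μ := (volume : Measure ℝ³)) (fun z => k z ^ q) y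
  rw [htr] at h
  exact h

/-- **Tonelli with a uniform inner bound.** For nonnegative measurable `F, G` and a jointly
measurable kernel `m`, if `∫ F(x) m(x, y) dx ≤ B` for every `y` then
`∫ F(x) (∫ G(y) m(x, y) dy) dx ≤ B ∫ G`. [folklore] -/
theorem lintegral_mul_lintegral_le {F G : ℝ³ → ℝ≥0∞} {m : ℝ³ → ℝ³ → ℝ≥0∞} (hF : Measurable F)
    (hG : Measurable G) (hm : Measurable (uncurry m)) {B : ℝ≥0∞}
    (hB : ∀ y, ∫⁻ x, F x * m x y ≤ B) :
    ∫⁻ x, F x * ∫⁻ y, G y * m x y ≤ B * ∫⁻ y, G y := by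
  have hmx : ∀ x, Measurable fun y => m x y := fun x => hm.comp measurable_prodMk_left
  have hmy : ∀ y, Measurable fun x => m x y := fun y => hm.comp measurable_prodMk_right
  have hunc : Measurable (uncurry fun x y => F x * (G y * m x y)) :=
    (hF.comp measurable_fst).mul ((hG.comp measurable_snd).mul hm)
  calc ∫⁻ x, F x * ∫⁻ y, G y * m x y = ∫⁻ x, ∫⁻ y, F x * (G y * m x y) := by
        refine lintegral_congr fun x => ?_
        have hmeas : Measurable fun y => G y * m x y := hG.mul (hmx x)
        rw [lintegral_const_mul _ hmeas]
    _ = ∫⁻ y, ∫⁻ x, F x * (G y * m x y) := lintegral_lintegral_swap hunc.aemeasurable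
    _ = ∫⁻ y, G y * ∫⁻ x, F x * m x y := by
        refine lintegral_congr fun y => ?_
        have hmeas : Measurable fun x => F x * m x y := hF.mul (hmy y)
        rw [← lintegral_const_mul _ hmeas]
        refine lintegral_congr fun x => ?_
        ring
    _ ≤ ∫⁻ y, G y * B := lintegral_mono fun y => mul_le_mul' le_rfl (hB y)
    _ = B * ∫⁻ y, G y := by
        rw [lintegral_mul_const _ hG, mul_comm]

end Abstract

/-! ## The cutoff: Lipschitz bound and the splitting of `θ⁶(x) - θ⁶(y)` -/

section CutoffPieces

variable {R r C₁ : ℝ}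

/-- **Mean value inequality for the cutoff:** `|θ(x) - θ(y)| ≤ (C₁/r)|x - y|` whenever
`‖Dθ‖ ≤ C₁/r` ((58)). [folklore] -/
theorem abs_taoCutoff_sub_le (hC : ∀ x : ℝ³, ‖fderiv ℝ (taoCutoff R r) x‖ ≤ C₁ / r) (x y : ℝ³) :
    |taoCutoff R r x - taoCutoff R r y| ≤ C₁ / r * ‖x - y‖ := by
  have hd : ∀ z ∈ (univ : Set ℝ³), DifferentiableAt ℝ (taoCutoff R r) z := fun z _ =>
    ((contDiff_taoCutoff (n := 1) R r).differentiable one_ne_zero) z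
  have h := Convex.norm_image_sub_le_of_norm_fderiv_le hd (fun z _ => hC z) convex_univ
    (mem_univ y) (mem_univ x)
  rwa [Real.norm_eq_abs] at h

/-- **Splitting of `a⁶ - b⁶` with the main part at `a`:** for `a, b ∈ [0, 1]`,
`|a⁶ - b⁶| ≤ 6a⁵|a - b| + 15(a - b)²`
(`a⁶ - b⁶ = 6a⁵(a - b) - (a - b)²(5a⁴ + 4a³b + 3a²b² + 2ab³ + b⁴)`). [folklore] -/
theorem abs_pow_six_sub_pow_six_le {a b : ℝ} (ha : 0 ≤ a) (ha1 : a ≤ 1) (hb : 0 ≤ b)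
    (hb1 : b ≤ 1) : |a ^ 6 - b ^ 6| ≤ 6 * a ^ 5 * |a - b| + 15 * (a - b) ^ 2 := by
  have key : a ^ 6 - b ^ 6 = 6 * a ^ 5 * (a - b) -
      (a - b) ^ 2 * (5 * a ^ 4 + 4 * a ^ 3 * b + 3 * a ^ 2 * b ^ 2 + 2 * a * b ^ 3 + b ^ 4) := by
    ring
  have hP0 : 0 ≤ 5 * a ^ 4 + 4 * a ^ 3 * b + 3 * a ^ 2 * b ^ 2 + 2 * a * b ^ 3 + b ^ 4 := by
    positivity
  have hP15 : 5 * a ^ 4 + 4 * a ^ 3 * b + 3 * a ^ 2 * b ^ 2 + 2 * a * b ^ 3 + b ^ 4 ≤ 15 := by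
    have m40 : a ^ 4 ≤ 1 := pow_le_one₀ ha ha1
    have m31 : a ^ 3 * b ≤ 1 := mul_le_one₀ (pow_le_one₀ ha ha1) hb hb1
    have m22 : a ^ 2 * b ^ 2 ≤ 1 :=
      mul_le_one₀ (pow_le_one₀ ha ha1) (by positivity) (pow_le_one₀ hb hb1)
    have m13 : a * b ^ 3 ≤ 1 := mul_le_one₀ ha1 (by positivity) (pow_le_one₀ hb hb1)
    have m04 : b ^ 4 ≤ 1 := pow_le_one₀ hb hb1
    linarith
  rw [key]
  calc |6 * a ^ 5 * (a - b) -
        (a - b) ^ 2 * (5 * a ^ 4 + 4 * a ^ 3 * b + 3 * a ^ 2 * b ^ 2 + 2 * a * b ^ 3 + b ^ 4)|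
      ≤ |6 * a ^ 5 * (a - b)| +
        |(a - b) ^ 2 * (5 * a ^ 4 + 4 * a ^ 3 * b + 3 * a ^ 2 * b ^ 2 + 2 * a * b ^ 3 + b ^ 4)| :=
        abs_sub _ _
    _ = 6 * a ^ 5 * |a - b| +
        (a - b) ^ 2 * (5 * a ^ 4 + 4 * a ^ 3 * b + 3 * a ^ 2 * b ^ 2 + 2 * a * b ^ 3 + b ^ 4) := by
        rw [abs_mul (6 * a ^ 5) (a - b), abs_mul ((a - b) ^ 2),
          abs_of_nonneg (by positivity : 0 ≤ 6 * a ^ 5), abs_of_nonneg (sq_nonneg (a - b)),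
          abs_of_nonneg hP0]
    _ ≤ 6 * a ^ 5 * |a - b| + (a - b) ^ 2 * 15 := by gcongr
    _ = _ := by ring

/-- The splitting for the cutoff: `|θ⁶(x) - θ⁶(y)| ≤ 6θ⁵(x)(C₁/r)|x-y| + 15(C₁/r)²|x-y|²`.
[folklore] -/
theorem abs_taoCutoff_pow_six_sub_le (hC : ∀ x : ℝ³, ‖fderiv ℝ (taoCutoff R r) x‖ ≤ C₁ / r)
    (x y : ℝ³) :
    |taoCutoff R r x ^ 6 - taoCutoff R r y ^ 6| ≤
      6 * taoCutoff R r x ^ 5 * (C₁ / r * ‖x - y‖) + 15 * (C₁ / r * ‖x - y‖) ^ 2 := by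
  have h1 := abs_pow_six_sub_pow_six_le (taoCutoff_nonneg R r x) (taoCutoff_le_one R r x)
    (taoCutoff_nonneg R r y) (taoCutoff_le_one R r y)
  have h2 := abs_taoCutoff_sub_le hC x y
  have h3 : (taoCutoff R r x - taoCutoff R r y) ^ 2 ≤ (C₁ / r * ‖x - y‖) ^ 2 := by
    calc (taoCutoff R r x - taoCutoff R r y) ^ 2 = |taoCutoff R r x - taoCutoff R r y| ^ 2 :=
          (sq_abs _).symm
      _ ≤ (C₁ / r * ‖x - y‖) ^ 2 := pow_le_pow_left₀ (abs_nonneg _) h2 2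
  have h4 : 0 ≤ 6 * taoCutoff R r x ^ 5 := by
    have := taoCutoff_nonneg R r x
    positivity
  calc |taoCutoff R r x ^ 6 - taoCutoff R r y ^ 6|
      ≤ 6 * taoCutoff R r x ^ 5 * |taoCutoff R r x - taoCutoff R r y| +
          15 * (taoCutoff R r x - taoCutoff R r y) ^ 2 := h1
    _ ≤ 6 * taoCutoff R r x ^ 5 * (C₁ / r * ‖x - y‖) + 15 * (C₁ / r * ‖x - y‖) ^ 2 := by
        gcongr

/-- Crude bound: `|θ⁶(x) - θ⁶(y)| ≤ 1`. [folklore] -/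
theorem abs_taoCutoff_pow_six_sub_le_one (R r : ℝ) (x y : ℝ³) :
    |taoCutoff R r x ^ 6 - taoCutoff R r y ^ 6| ≤ 1 := by
  have h0x := taoCutoff_pow_nonneg R r x 6
  have h1x := taoCutoff_pow_le_one R r x 6
  have h0y := taoCutoff_pow_nonneg R r y 6
  have h1y := taoCutoff_pow_le_one R r y 6
  rw [abs_le]
  constructor <;> linarith

end CutoffPieces

/-! ## The commutator kernel `k(x, y) = (θ⁶(x) - θ⁶(y)) K(x - y)(v(y))` -/

section Commutator

variable {R r C₁ : ℝ} {v : ℝ³ → ℝ³}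

/-- The **commutator kernel** of `θ⁶ p̃[v] - p̃[θ³v]`:
`k(x, y) = (θ⁶(x) - θ⁶(y)) K(x - y)(v(y))`, `θ = taoCutoff R r`, `K = NS.pressureKernel`
(Tao's `[Δ⁻¹∇², η³]`, `η = θ²`). [cite: Tao2011, §8, proof of Lemma 8.1, `X₅,₂`] -/
def commKernel (R r : ℝ) (v : ℝ³ → ℝ³) (x y : ℝ³) : ℝ :=
  (taoCutoff R r x ^ 6 - taoCutoff R r y ^ 6) * pressureKernel (x - y) (v y)

/-- The commutator kernel vanishes on the diagonal. [folklore] -/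
@[simp] theorem commKernel_self (R r : ℝ) (v : ℝ³ → ℝ³) (x : ℝ³) : commKernel R r v x x = 0 := by
  simp [commKernel]

/-- The **majorant** of the commutator kernel: with `d = |x - y|`,
`|k(x,y)| ≤ (|v(y)|²/(2π)) (1_{d≥r}d⁻³ + 6(C₁/r)θ⁵(x) 1_{d<r}d⁻² + 15(C₁/r)² 1_{d<r}d⁻¹)`
(kernel size `|K(z)(a)| ≤ |a|²/(2π|z|³)`, the splitting of `θ⁶(x) - θ⁶(y)` on `d < r` and the crude
bound `1` on `d ≥ r`). [cite: Tao2011, §8, proof of Lemma 8.1, `X₅,₂`] -/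
def commMajorant (R r C₁ : ℝ) (v : ℝ³ → ℝ³) (x y : ℝ³) : ℝ :=
  ‖v y‖ ^ 2 / (2 * Real.pi) *
    (farProfile r ‖x - y‖ + 6 * (C₁ / r) * taoCutoff R r x ^ 5 * nearProfile₂ r ‖x - y‖ +
      15 * (C₁ / r) ^ 2 * nearProfile₁ r ‖x - y‖)

/-- The majorant is nonnegative (`C₁/r ≥ 0`). [folklore] -/
theorem commMajorant_nonneg (hC0 : 0 ≤ C₁ / r) (x y : ℝ³) : 0 ≤ commMajorant R r C₁ v x y := by
  unfold commMajorant
  have h1 := farProfile_nonneg r (norm_nonneg (x - y))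
  have h2 := nearProfile₂_nonneg r ‖x - y‖
  have h3 := nearProfile₁_nonneg r (norm_nonneg (x - y))
  have h4 := taoCutoff_nonneg R r x
  positivity

/-- **Pointwise domination of the commutator kernel by its majorant.** [cite: Tao2011, §8, proof of Lemma 8.1, `X₅,₂`] -/
theorem abs_commKernel_le (hC : ∀ x : ℝ³, ‖fderiv ℝ (taoCutoff R r) x‖ ≤ C₁ / r)
    (hC0 : 0 ≤ C₁ / r) (x y : ℝ³) :
    |commKernel R r v x y| ≤ commMajorant R r C₁ v x y := by
  rcases eq_or_ne x y with rfl | hxy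
  · rw [commKernel_self, abs_zero]
    exact commMajorant_nonneg hC0 x x
  have hd : 0 < ‖x - y‖ := norm_pos_iff.2 (sub_ne_zero.2 hxy)
  set d := ‖x - y‖ with hd_def
  have hK := abs_pressureKernel_le (x - y) (v y)
  rw [← hd_def] at hK
  have hθ0 : 0 ≤ taoCutoff R r x := taoCutoff_nonneg R r x
  unfold commKernel commMajorant
  rw [abs_mul, ← hd_def]
  by_cases hdr : r ≤ d
  · -- far region: `|θ⁶x - θ⁶y| ≤ 1`
    have hfar : farProfile r d = (d ^ 3)⁻¹ := if_pos hdr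
    have hn2 : nearProfile₂ r d = 0 := if_neg (not_lt.2 hdr)
    have hn1 : nearProfile₁ r d = 0 := if_neg (not_lt.2 hdr)
    rw [hfar, hn2, hn1, mul_zero, mul_zero, add_zero, add_zero]
    calc |taoCutoff R r x ^ 6 - taoCutoff R r y ^ 6| * |pressureKernel (x - y) (v y)|
        ≤ 1 * (‖v y‖ ^ 2 / (2 * Real.pi * d ^ 3)) :=
          mul_le_mul (abs_taoCutoff_pow_six_sub_le_one R r x y) hK (abs_nonneg _) zero_le_one
      _ = ‖v y‖ ^ 2 / (2 * Real.pi) * (d ^ 3)⁻¹ := by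
          field_simp
  · -- near region: the splitting
    push Not at hdr
    have hfar : farProfile r d = 0 := if_neg (not_le.2 hdr)
    have hn2 : nearProfile₂ r d = (d ^ 2)⁻¹ := if_pos hdr
    have hn1 : nearProfile₁ r d = d⁻¹ := if_pos hdr
    rw [hfar, hn2, hn1, zero_add]
    have hsplit := abs_taoCutoff_pow_six_sub_le hC x y
    rw [← hd_def] at hsplit
    calc |taoCutoff R r x ^ 6 - taoCutoff R r y ^ 6| * |pressureKernel (x - y) (v y)|
        ≤ (6 * taoCutoff R r x ^ 5 * (C₁ / r * d) + 15 * (C₁ / r * d) ^ 2) *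
            (‖v y‖ ^ 2 / (2 * Real.pi * d ^ 3)) :=
          mul_le_mul hsplit hK (abs_nonneg _) (by positivity)
      _ = ‖v y‖ ^ 2 / (2 * Real.pi) *
            (6 * (C₁ / r) * taoCutoff R r x ^ 5 * (d ^ 2)⁻¹ + 15 * (C₁ / r) ^ 2 * d⁻¹) := by
          field_simp

/-- Joint measurability of the commutator kernel. [folklore] -/
theorem measurable_commKernel (hv : Continuous v) :
    Measurable (uncurry (commKernel R r v)) := by
  have h1 : Measurable fun p : ℝ³ × ℝ³ => taoCutoff R r p.1 ^ 6 - taoCutoff R r p.2 ^ 6 :=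
    (((continuous_taoCutoff R r).measurable.comp measurable_fst).pow_const 6).sub
      (((continuous_taoCutoff R r).measurable.comp measurable_snd).pow_const 6)
  have h3 : Measurable fun p : ℝ³ × ℝ³ => (p.1 - p.2, v p.2) :=
    (measurable_fst.sub measurable_snd).prodMk (hv.measurable.comp measurable_snd)
  have h2 : Measurable ((fun q : ℝ³ × ℝ³ => pressureKernel q.1 q.2) ∘
      fun p : ℝ³ × ℝ³ => (p.1 - p.2, v p.2)) :=
    measurable_pressureKernel.comp h3
  exact h1.mul h2

/-- Measurability of the commutator kernel in `y` for fixed `x`. [folklore] -/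
theorem measurable_commKernel_right (hv : Continuous v) (x : ℝ³) :
    Measurable fun y => commKernel R r v x y := by
  have h1 : Measurable fun y : ℝ³ => taoCutoff R r x ^ 6 - taoCutoff R r y ^ 6 :=
    measurable_const.sub ((continuous_taoCutoff R r).measurable.pow_const 6)
  have h3 : Measurable fun y : ℝ³ => (x - y, v y) :=
    (measurable_const.sub measurable_id).prodMk hv.measurable
  have h2 : Measurable ((fun q : ℝ³ × ℝ³ => pressureKernel q.1 q.2) ∘ fun y : ℝ³ => (x - y, v y)) :=
    measurable_pressureKernel.comp h3
  exact h1.mul h2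

/-- For `0 ≤ ρ`, `1_{ρ<r}ρ⁻¹ ≤ r · 1_{ρ<r}ρ⁻²`. [folklore] -/
theorem nearProfile₁_le (r : ℝ) {ρ : ℝ} (hρ : 0 ≤ ρ) : nearProfile₁ r ρ ≤ r * nearProfile₂ r ρ := by
  unfold nearProfile₁ nearProfile₂
  by_cases h : ρ < r
  · rw [if_pos h, if_pos h]
    rcases eq_or_lt_of_le hρ with rfl | hρ'
    · simp
    · have h1 : ρ⁻¹ = ρ * (ρ ^ 2)⁻¹ := by field_simp
      rw [h1]
      exact mul_le_mul_of_nonneg_right h.le (by positivity)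
  · rw [if_neg h, if_neg h, mul_zero]

/-- `1_{ρ<r}ρ⁻² = (1_{ρ<r}ρ⁻¹)²`. [folklore] -/
theorem nearProfile₂_eq_sq (r ρ : ℝ) : nearProfile₂ r ρ = nearProfile₁ r ρ ^ 2 := by
  unfold nearProfile₂ nearProfile₁
  split_ifs
  · rw [inv_pow]
  · ring

/-- The first near kernel `z ↦ 1_{|z|<r}|z|⁻²` is integrable on `ℝ³` (`∫ = 4πr`). [folklore] -/
theorem integrable_nearProfile₂_norm (hr : 0 < r) : Integrable fun z : ℝ³ => nearProfile₂ r ‖z‖ := by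
  have h := (integral_nearProfile₁_norm_sq (r := r) hr).1
  refine h.congr (Eventually.of_forall fun z => ?_)
  simp only [nearProfile₂_eq_sq]

/-- **An integrable majorant of the commutator kernel for fixed `x`.** If `|v| ≤ M` on
`B̄(x, r)` then `commMajorant x y ≤ |v(y)|²/(2π r³) + (M²/(2π))(6C₁/r + 15(C₁/r)² r) 1_{|x-y|<r}|x-y|⁻²`.
[folklore] -/
theorem commMajorant_le (hr : 0 < r) (hC0 : 0 ≤ C₁ / r) (x : ℝ³) {M : ℝ}
    (hM : ∀ y ∈ closedBall x r, ‖v y‖ ≤ M) (y : ℝ³) :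
    commMajorant R r C₁ v x y ≤
      ‖v y‖ ^ 2 / (2 * Real.pi) * (r ^ 3)⁻¹ +
        M ^ 2 / (2 * Real.pi) * (6 * (C₁ / r) + 15 * (C₁ / r) ^ 2 * r) * nearProfile₂ r ‖x - y‖ := by
  have hθ0 : 0 ≤ taoCutoff R r x := taoCutoff_nonneg R r x
  have hθ1 : taoCutoff R r x ^ 5 ≤ 1 := taoCutoff_pow_le_one R r x 5
  have hn2 : 0 ≤ nearProfile₂ r ‖x - y‖ := nearProfile₂_nonneg r _
  -- far profile ≤ r⁻³
  have hfar : farProfile r ‖x - y‖ ≤ (r ^ 3)⁻¹ := by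
    unfold farProfile
    split_ifs with h
    · exact inv_anti₀ (by positivity) (pow_le_pow_left₀ hr.le h 3)
    · positivity
  -- on the support of the near profiles `|v y| ≤ M`
  have hvM : ‖v y‖ ^ 2 * nearProfile₂ r ‖x - y‖ ≤ M ^ 2 * nearProfile₂ r ‖x - y‖ := by
    by_cases h : ‖x - y‖ < r
    · have hy : y ∈ closedBall x r := by
        rw [mem_closedBall, dist_eq_norm, ← norm_neg, neg_sub]
        exact h.le
      exact mul_le_mul_of_nonneg_right (pow_le_pow_left₀ (norm_nonneg _) (hM y hy) 2) hn2
    · have : nearProfile₂ r ‖x - y‖ = 0 := if_neg h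
      rw [this, mul_zero, mul_zero]
  have hn1 : nearProfile₁ r ‖x - y‖ ≤ r * nearProfile₂ r ‖x - y‖ := nearProfile₁_le r (norm_nonneg _)
  unfold commMajorant
  have hpi : 0 < 2 * Real.pi := by positivity
  calc ‖v y‖ ^ 2 / (2 * Real.pi) *
        (farProfile r ‖x - y‖ + 6 * (C₁ / r) * taoCutoff R r x ^ 5 * nearProfile₂ r ‖x - y‖ +
          15 * (C₁ / r) ^ 2 * nearProfile₁ r ‖x - y‖)
      ≤ ‖v y‖ ^ 2 / (2 * Real.pi) *
        ((r ^ 3)⁻¹ + 6 * (C₁ / r) * 1 * nearProfile₂ r ‖x - y‖ +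
          15 * (C₁ / r) ^ 2 * (r * nearProfile₂ r ‖x - y‖)) := by
        gcongr
    _ = ‖v y‖ ^ 2 / (2 * Real.pi) * (r ^ 3)⁻¹ +
        (6 * (C₁ / r) + 15 * (C₁ / r) ^ 2 * r) / (2 * Real.pi) *
          (‖v y‖ ^ 2 * nearProfile₂ r ‖x - y‖) := by ring
    _ ≤ ‖v y‖ ^ 2 / (2 * Real.pi) * (r ^ 3)⁻¹ +
        (6 * (C₁ / r) + 15 * (C₁ / r) ^ 2 * r) / (2 * Real.pi) *
          (M ^ 2 * nearProfile₂ r ‖x - y‖) := by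
        gcongr
    _ = _ := by ring

/-- A continuous field is bounded on `B̄(x, r)`. [folklore] -/
theorem exists_bound_closedBall (hv : Continuous v) (x : ℝ³) (r : ℝ) :
    ∃ M : ℝ, 0 ≤ M ∧ ∀ y ∈ closedBall x r, ‖v y‖ ≤ M := by
  obtain ⟨M, hM⟩ := (isCompact_closedBall x r).exists_bound_of_continuousOn hv.continuousOn
  exact ⟨max M 0, le_max_right _ _, fun y hy => (hM y hy).trans (le_max_left _ _)⟩

/-- The integrable bound of `commMajorant_le` is integrable (`v ∈ L²`, `1_{|z|<r}|z|⁻² ∈ L¹`).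
[folklore] -/
theorem integrable_commBound (hv2 : Integrable fun y => ‖v y‖ ^ 2) (hr : 0 < r) (x : ℝ³)
    (M K : ℝ) :
    Integrable fun y => ‖v y‖ ^ 2 / (2 * Real.pi) * (r ^ 3)⁻¹ +
      M ^ 2 / (2 * Real.pi) * K * nearProfile₂ r ‖x - y‖ := by
  refine Integrable.add ?_ ?_
  · have := (hv2.div_const (2 * Real.pi)).mul_const (r ^ 3)⁻¹
    exact this
  · have h := ((integrable_nearProfile₂_norm (r := r) hr).comp_sub_left x).const_mul
      (M ^ 2 / (2 * Real.pi) * K)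
    exact h

/-- **The commutator kernel is absolutely integrable in `y`** for every `x`
(`v` continuous with `|v|² ∈ L¹`). [folklore] -/
theorem integrable_commKernel_right (hv : Continuous v) (hv2 : Integrable fun y => ‖v y‖ ^ 2)
    (hr : 0 < r) (hC : ∀ x : ℝ³, ‖fderiv ℝ (taoCutoff R r) x‖ ≤ C₁ / r) (hC0 : 0 ≤ C₁ / r)
    (x : ℝ³) : Integrable fun y => commKernel R r v x y := by
  obtain ⟨M, -, hM⟩ := exists_bound_closedBall hv x r
  refine (integrable_commBound hv2 hr x M (6 * (C₁ / r) + 15 * (C₁ / r) ^ 2 * r)).mono'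
    (measurable_commKernel_right hv x).aestronglyMeasurable (Eventually.of_forall fun y => ?_)
  rw [Real.norm_eq_abs]
  exact (abs_commKernel_le hC hC0 x y).trans (commMajorant_le hr hC0 x hM y)

/-- Exhaustion of the whole-space integral by the truncated ones: for `f ∈ L¹(ℝ³)`,
`∫_{|y-x|>ε} f → ∫ f` as `ε → 0⁺` (dominated convergence; the point `{x}` is null). [folklore] -/
theorem tendsto_setIntegral_compl_closedBall {f : ℝ³ → ℝ} (hf : Integrable f) (x : ℝ³) :
    Tendsto (fun ε => ∫ y in (closedBall x ε)ᶜ, f y) (𝓝[>] 0) (𝓝 (∫ y, f y)) := by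
  have heq : (fun ε => ∫ y in (closedBall x ε)ᶜ, f y) =
      fun ε => ∫ y, ((closedBall x ε)ᶜ).indicator f y := by
    funext ε
    rw [integral_indicator measurableSet_closedBall.compl]
  rw [heq]
  refine tendsto_integral_filter_of_dominated_convergence (fun y => ‖f y‖) ?_ ?_ hf.norm ?_
  · exact Eventually.of_forall fun ε =>
      hf.aestronglyMeasurable.indicator measurableSet_closedBall.compl
  · exact Eventually.of_forall fun ε => Eventually.of_forall fun y => norm_indicator_le_norm_self _ _
  · have hae : ∀ᵐ y ∂(volume : Measure ℝ³), y ≠ x := by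
      rw [ae_iff]
      refine measure_mono_null (fun y hy => ?_) (measure_singleton x)
      simpa using hy
    filter_upwards [hae] with y hy
    have hpos : 0 < dist y x := dist_pos.2 hy
    have hev : ∀ᶠ ε in 𝓝[>] (0 : ℝ), ε < dist y x :=
      (eventually_lt_nhds hpos).filter_mono nhdsWithin_le_nhds
    refine tendsto_const_nhds.congr' ?_
    filter_upwards [hev] with ε hε
    rw [indicator_of_mem]
    rw [mem_compl_iff, mem_closedBall, not_le]
    exact hε

/-- **The commutator representation (needs the principal values, `NS.hasPressurePV_of_contDiff`).**
For `v ∈ C¹ ∩ L²` and every `x`: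
`θ⁶(x) p̃[v](x) - p̃[θ³v](x) = ∫ (θ⁶(x) - θ⁶(y)) K(x-y)(v(y)) dy`
(both principal values exist; `K(z)(θ³(y)a) = θ⁶(y)K(z)(a)`; the local terms `-|·|²/3` cancel; the
difference of the truncated integrals is the truncated integral of the commutator kernel, which is
absolutely integrable, so dominated convergence identifies the limit). This is the kernel form of
Tao's commutator `[Δ⁻¹∇², η³]`. [cite: Tao2011, §8, proof of Lemma 8.1, `X₅,₂`] -/
theorem commutator_eq_integral (hPV : hasPressurePV_of_contDiff) (hv : ContDiff ℝ 1 v)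
    (hE : ∫⁻ x, ‖v x‖ₑ ^ 2 < ⊤) (hv2 : Integrable fun y => ‖v y‖ ^ 2) (hr : 0 < r)
    (hC : ∀ x : ℝ³, ‖fderiv ℝ (taoCutoff R r) x‖ ≤ C₁ / r) (hC0 : 0 ≤ C₁ / r) (x : ℝ³) :
    taoCutoff R r x ^ 6 * normalisedPressure v x -
        normalisedPressure (fun y => taoCutoff R r y ^ 3 • v y) x =
      ∫ y, commKernel R r v x y := by
  have hw1 : ContDiff ℝ 1 (fun y => taoCutoff R r y ^ 3 • v y) :=
    (contDiff_taoCutoff_pow R r 3).smul hv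
  have hwle : ∀ y, ‖taoCutoff R r y ^ 3 • v y‖ ≤ ‖v y‖ := fun y => by
    rw [norm_smul, Real.norm_eq_abs, abs_of_nonneg (taoCutoff_pow_nonneg R r y 3)]
    exact mul_le_of_le_one_left (norm_nonneg _) (taoCutoff_pow_le_one R r y 3)
  have hwE : ∫⁻ y, ‖taoCutoff R r y ^ 3 • v y‖ₑ ^ 2 < ⊤ := by
    refine lt_of_le_of_lt (lintegral_mono fun y => ?_) hE
    have h : ‖taoCutoff R r y ^ 3 • v y‖ₑ ≤ ‖v y‖ₑ := by
      rw [← ofReal_norm, ← ofReal_norm]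
      exact ENNReal.ofReal_le_ofReal (hwle y)
    gcongr
  obtain ⟨L₁, hL₁⟩ := hPV v hv hE x
  obtain ⟨L₂, hL₂⟩ := hPV _ hw1 hwE x
  rw [normalisedPressure_eq hL₁, normalisedPressure_eq hL₂]
  have hwx : ‖taoCutoff R r x ^ 3 • v x‖ ^ 2 = taoCutoff R r x ^ 6 * ‖v x‖ ^ 2 := by
    rw [norm_smul, Real.norm_eq_abs, abs_of_nonneg (taoCutoff_pow_nonneg R r x 3)]
    ring
  rw [hwx]
  -- the limits
  have hlim1 : Tendsto (fun ε => taoCutoff R r x ^ 6 * truncatedPressureIntegral v x ε -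
      truncatedPressureIntegral (fun y => taoCutoff R r y ^ 3 • v y) x ε) (𝓝[>] 0)
      (𝓝 (taoCutoff R r x ^ 6 * L₁ - L₂)) :=
    (hL₁.2.const_mul _).sub hL₂.2
  have heq : ∀ᶠ ε in 𝓝[>] (0 : ℝ), taoCutoff R r x ^ 6 * truncatedPressureIntegral v x ε -
      truncatedPressureIntegral (fun y => taoCutoff R r y ^ 3 • v y) x ε =
        ∫ y in (closedBall x ε)ᶜ, commKernel R r v x y := by
    filter_upwards [hL₁.1, hL₂.1] with ε h1 h2
    rw [truncatedPressureIntegral, truncatedPressureIntegral, ← integral_const_mul,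
      ← integral_sub (h1.const_mul _) h2]
    refine setIntegral_congr_fun measurableSet_closedBall.compl fun y _ => ?_
    rw [commKernel, pressureKernel_smul_right]
    ring
  have hlim2 := tendsto_setIntegral_compl_closedBall
    (integrable_commKernel_right hv.continuous hv2 hr hC hC0 x) x
  have key : taoCutoff R r x ^ 6 * L₁ - L₂ = ∫ y, commKernel R r v x y :=
    tendsto_nhds_unique (hlim1.congr' heq) hlim2
  linear_combination key

/-- The commutator `x ↦ ∫ k(x, y) dy` is a (strongly) measurable function of `x` (Fubini
measurability of a jointly measurable kernel). [folklore] -/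
theorem stronglyMeasurable_integral_commKernel (hv : Continuous v) :
    StronglyMeasurable fun x => ∫ y, commKernel R r v x y :=
  (measurable_commKernel (R := R) (r := r) hv).stronglyMeasurable.integral_prod_right

end Commutator

/-! ## The three kernels in `ℝ≥0∞` form: Lebesgue norms and the Hölder step -/

section KernelNorms

variable {r : ℝ}

/-- `∫⁻ (1_{|z|≥r}|z|⁻³)² = 4π/(3r³)`. [folklore] -/
theorem lintegral_farProfile_norm_sq (hr : 0 < r) :
    ∫⁻ z : ℝ³, ENNReal.ofReal (farProfile r ‖z‖) ^ 2 =
      ENNReal.ofReal (4 * Real.pi / (3 * r ^ 3)) := by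
  obtain ⟨hi, he⟩ := integral_farProfile_norm_sq (r := r) hr
  rw [← he, ofReal_integral_eq_lintegral_ofReal hi (ae_of_all _ fun z => sq_nonneg _)]
  refine lintegral_congr fun z => ?_
  rw [ENNReal.ofReal_pow (farProfile_nonneg r (norm_nonneg z))]

/-- `∫⁻ (1_{|z|<r}|z|⁻²)^{6/5} = (20π/3) r^{3/5}`. [folklore] -/
theorem lintegral_nearProfile₂_norm_rpow (hr : 0 < r) :
    ∫⁻ z : ℝ³, ENNReal.ofReal (nearProfile₂ r ‖z‖) ^ (6 / 5 : ℝ) =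
      ENNReal.ofReal (20 * Real.pi / 3 * r ^ (3 / 5 : ℝ)) := by
  obtain ⟨hi, he⟩ := integral_nearProfile₂_norm_rpow (r := r) hr
  rw [← he, ofReal_integral_eq_lintegral_ofReal hi
    (ae_of_all _ fun z => Real.rpow_nonneg (nearProfile₂_nonneg r _) _)]
  refine lintegral_congr fun z => ?_
  rw [ENNReal.ofReal_rpow_of_nonneg (nearProfile₂_nonneg r _) (by norm_num)]

/-- `∫⁻ (1_{|z|<r}|z|⁻¹)² = 4πr`. [folklore] -/
theorem lintegral_nearProfile₁_norm_sq (hr : 0 < r) :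
    ∫⁻ z : ℝ³, ENNReal.ofReal (nearProfile₁ r ‖z‖) ^ 2 = ENNReal.ofReal (4 * Real.pi * r) := by
  obtain ⟨hi, he⟩ := integral_nearProfile₁_norm_sq (r := r) hr
  rw [← he, ofReal_integral_eq_lintegral_ofReal hi (ae_of_all _ fun z => sq_nonneg _)]
  refine lintegral_congr fun z => ?_
  rw [ENNReal.ofReal_pow (nearProfile₁_nonneg r (norm_nonneg z))]

/-- Measurability of the `ℝ≥0∞` kernels `z ↦ ofReal (φ |z|)` for a measurable profile `φ`.
[folklore] -/
theorem measurable_ofReal_profile_norm {φ : ℝ → ℝ} (hφ : Measurable φ) :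
    Measurable fun z : ℝ³ => ENNReal.ofReal (φ ‖z‖) :=
  ENNReal.measurable_ofReal.comp (hφ.comp measurable_norm)

/-- **Far kernel, Hölder `L² × L²`:** `∫ F(x) 1_{|x-y|≥r}|x-y|⁻³ dx ≤ ‖F‖_{L²} √(4π/(3r³))`.
[folklore] -/
theorem lintegral_mul_farProfile_le (hr : 0 < r) {F : ℝ³ → ℝ≥0∞} (hF : Measurable F) (y : ℝ³) :
    ∫⁻ x, F x * ENNReal.ofReal (farProfile r ‖x - y‖) ≤
      (∫⁻ x, F x ^ 2) ^ (1 / 2 : ℝ) * ENNReal.ofReal (Real.sqrt (4 * Real.pi / (3 * r ^ 3))) := by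
  have h := lintegral_mul_shift_le Real.HolderConjugate.two_two hF
    (measurable_ofReal_profile_norm (measurable_farProfile r)) y
  simp only [ENNReal.rpow_two] at h
  rw [lintegral_farProfile_norm_sq hr,
    ENNReal.ofReal_rpow_of_nonneg (by positivity) (by norm_num), ← Real.sqrt_eq_rpow] at h
  exact h

/-- **First near kernel, Hölder `L⁶ × L^{6/5}`:**
`∫ F(x) 1_{|x-y|<r}|x-y|⁻² dx ≤ ‖F‖_{L⁶} ((20π/3) r^{3/5})^{5/6}`. [folklore] -/
theorem lintegral_mul_nearProfile₂_le (hr : 0 < r) {F : ℝ³ → ℝ≥0∞} (hF : Measurable F) (y : ℝ³) :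
    ∫⁻ x, F x * ENNReal.ofReal (nearProfile₂ r ‖x - y‖) ≤
      (∫⁻ x, F x ^ (6 : ℝ)) ^ (1 / 6 : ℝ) *
        ENNReal.ofReal ((20 * Real.pi / 3 * r ^ (3 / 5 : ℝ)) ^ (5 / 6 : ℝ)) := by
  have hpq : (6 : ℝ).HolderConjugate (6 / 5) := Real.holderConjugate_iff.2 ⟨by norm_num, by norm_num⟩
  have h := lintegral_mul_shift_le hpq hF
    (measurable_ofReal_profile_norm (measurable_nearProfile₂ r)) y
  rw [lintegral_nearProfile₂_norm_rpow hr,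
    ENNReal.ofReal_rpow_of_nonneg (by positivity) (by norm_num)] at h
  convert h using 3
  norm_num

/-- **Second near kernel, Hölder `L² × L²`:** `∫ F(x) 1_{|x-y|<r}|x-y|⁻¹ dx ≤ ‖F‖_{L²} √(4πr)`.
[folklore] -/
theorem lintegral_mul_nearProfile₁_le (hr : 0 < r) {F : ℝ³ → ℝ≥0∞} (hF : Measurable F) (y : ℝ³) :
    ∫⁻ x, F x * ENNReal.ofReal (nearProfile₁ r ‖x - y‖) ≤
      (∫⁻ x, F x ^ 2) ^ (1 / 2 : ℝ) * ENNReal.ofReal (Real.sqrt (4 * Real.pi * r)) := by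
  have h := lintegral_mul_shift_le Real.HolderConjugate.two_two hF
    (measurable_ofReal_profile_norm (measurable_nearProfile₁ r)) y
  simp only [ENNReal.rpow_two] at h
  rw [lintegral_nearProfile₁_norm_sq hr,
    ENNReal.ofReal_rpow_of_nonneg (by positivity) (by norm_num), ← Real.sqrt_eq_rpow] at h
  exact h

end KernelNorms

/-! ## The commutator term: `∫ |θ Dθ(v)| |∫ k(·,y) dy| ≲ A³ r^{-5/2} + A² r^{-3/2} ‖θ⁶v‖_{L⁶}` -/

section CommutatorBound

variable {R r C₁ : ℝ} {v : ℝ³ → ℝ³}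

/-- The velocity energy density in `ℝ≥0∞` form: `‖v y‖ₑ² = ofReal (|v y|²)`. [folklore] -/
theorem enorm_sq_eq_ofReal (v : ℝ³ → ℝ³) (y : ℝ³) : ‖v y‖ₑ ^ 2 = ENNReal.ofReal (‖v y‖ ^ 2) := by
  rw [← ofReal_norm, ENNReal.ofReal_pow (norm_nonneg _)]

/-- The majorant in `ℝ≥0∞` form, multiplied out. [folklore] -/
theorem ofReal_commMajorant_eq (hC0 : 0 ≤ C₁ / r) (x y : ℝ³) :
    ENNReal.ofReal (commMajorant R r C₁ v x y) =
      ENNReal.ofReal (1 / (2 * Real.pi)) *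
        (‖v y‖ₑ ^ 2 * ENNReal.ofReal (farProfile r ‖x - y‖) +
          ENNReal.ofReal (6 * (C₁ / r) * taoCutoff R r x ^ 5) *
              (‖v y‖ₑ ^ 2 * ENNReal.ofReal (nearProfile₂ r ‖x - y‖)) +
            ENNReal.ofReal (15 * (C₁ / r) ^ 2) *
              (‖v y‖ₑ ^ 2 * ENNReal.ofReal (nearProfile₁ r ‖x - y‖))) := by
  have h1 := farProfile_nonneg r (norm_nonneg (x - y))
  have h2 := nearProfile₂_nonneg r ‖x - y‖
  have h3 := nearProfile₁_nonneg r (norm_nonneg (x - y))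
  have hθ := taoCutoff_pow_nonneg R r x 5
  have hv := sq_nonneg ‖v y‖
  have hpi : 0 ≤ 1 / (2 * Real.pi) := by positivity
  have h6 : 0 ≤ 6 * (C₁ / r) * taoCutoff R r x ^ 5 := by positivity
  have h15 : 0 ≤ 15 * (C₁ / r) ^ 2 := by positivity
  rw [enorm_sq_eq_ofReal]
  rw [← ENNReal.ofReal_mul hv, ← ENNReal.ofReal_mul hv, ← ENNReal.ofReal_mul hv,
    ← ENNReal.ofReal_mul h6, ← ENNReal.ofReal_mul h15,
    ← ENNReal.ofReal_add (by positivity) (by positivity),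
    ← ENNReal.ofReal_add (by positivity) (by positivity), ← ENNReal.ofReal_mul hpi]
  congr 1
  unfold commMajorant
  ring

/-- **The commutator at a point is dominated by the three convolutions:**
`∫ |k(x,y)| dy ≤ (2π)⁻¹ (∫|v|²far + 6(C₁/r)θ⁵(x) ∫|v|²near₂ + 15(C₁/r)² ∫|v|²near₁)` (all in `ℝ≥0∞`).
[cite: Tao2011, §8, proof of Lemma 8.1, `X₅,₂`] -/
theorem lintegral_enorm_commKernel_le (hv : Continuous v)
    (hC : ∀ x : ℝ³, ‖fderiv ℝ (taoCutoff R r) x‖ ≤ C₁ / r) (hC0 : 0 ≤ C₁ / r) (x : ℝ³) :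
    ∫⁻ y, ‖commKernel R r v x y‖ₑ ≤
      ENNReal.ofReal (1 / (2 * Real.pi)) *
        ((∫⁻ y, ‖v y‖ₑ ^ 2 * ENNReal.ofReal (farProfile r ‖x - y‖)) +
          ENNReal.ofReal (6 * (C₁ / r) * taoCutoff R r x ^ 5) *
              (∫⁻ y, ‖v y‖ₑ ^ 2 * ENNReal.ofReal (nearProfile₂ r ‖x - y‖)) +
            ENNReal.ofReal (15 * (C₁ / r) ^ 2) *
              (∫⁻ y, ‖v y‖ₑ ^ 2 * ENNReal.ofReal (nearProfile₁ r ‖x - y‖))) := by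
  have hvm : Measurable fun y => ‖v y‖ₑ ^ 2 := hv.measurable.enorm.pow_const 2
  have hk : ∀ {φ : ℝ → ℝ}, Measurable φ →
      Measurable fun y : ℝ³ => ‖v y‖ₑ ^ 2 * ENNReal.ofReal (φ ‖x - y‖) := fun hφ =>
    hvm.mul (ENNReal.measurable_ofReal.comp (hφ.comp (measurable_const.sub measurable_id).norm))
  have hfar := hk (measurable_farProfile r)
  have hn2 := hk (measurable_nearProfile₂ r)
  have hn1 := hk (measurable_nearProfile₁ r)
  calc ∫⁻ y, ‖commKernel R r v x y‖ₑ ≤ ∫⁻ y, ENNReal.ofReal (commMajorant R r C₁ v x y) := by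
        refine lintegral_mono fun y => ?_
        rw [← ofReal_norm, Real.norm_eq_abs]
        exact ENNReal.ofReal_le_ofReal (abs_commKernel_le hC hC0 x y)
    _ = _ := by
        simp_rw [ofReal_commMajorant_eq hC0 x]
        have h12 : Measurable fun a => ‖v a‖ₑ ^ 2 * ENNReal.ofReal (farProfile r ‖x - a‖) +
            ENNReal.ofReal (6 * (C₁ / r) * taoCutoff R r x ^ 5) *
              (‖v a‖ₑ ^ 2 * ENNReal.ofReal (nearProfile₂ r ‖x - a‖)) := hfar.add (hn2.const_mul _)
        rw [lintegral_const_mul' _ _ ENNReal.ofReal_ne_top, lintegral_add_left h12,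
          lintegral_add_left hfar, lintegral_const_mul _ hn2, lintegral_const_mul _ hn1]

/-- Tonelli step for a convolution kernel: if `∫ F(x) φ(|x-y|) dx ≤ B` for all `y`, then
`∫ F(x) (∫ |v(y)|² φ(|x-y|) dy) dx ≤ B ∫|v|²`. [folklore] -/
theorem lintegral_mul_conv_le (hv : Continuous v) {φ : ℝ → ℝ} (hφ : Measurable φ)
    {F : ℝ³ → ℝ≥0∞} (hF : Measurable F) {B : ℝ≥0∞}
    (hB : ∀ y, ∫⁻ x, F x * ENNReal.ofReal (φ ‖x - y‖) ≤ B) :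
    ∫⁻ x, F x * ∫⁻ y, ‖v y‖ₑ ^ 2 * ENNReal.ofReal (φ ‖x - y‖) ≤ B * ∫⁻ y, ‖v y‖ₑ ^ 2 := by
  have hm : Measurable (uncurry fun x y : ℝ³ => ENNReal.ofReal (φ ‖x - y‖)) :=
    ENNReal.measurable_ofReal.comp (hφ.comp (measurable_fst.sub measurable_snd).norm)
  exact lintegral_mul_lintegral_le hF (hv.measurable.enorm.pow_const 2) hm hB

/-- Measurability in `x` of the convolutions `∫ |v(y)|² φ(|x-y|) dy`. [folklore] -/
theorem measurable_lintegral_conv (hv : Continuous v) {φ : ℝ → ℝ} (hφ : Measurable φ) :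
    Measurable fun x : ℝ³ => ∫⁻ y, ‖v y‖ₑ ^ 2 * ENNReal.ofReal (φ ‖x - y‖) := by
  have hm : Measurable fun p : ℝ³ × ℝ³ => ‖v p.2‖ₑ ^ 2 * ENNReal.ofReal (φ ‖p.1 - p.2‖) :=
    ((hv.measurable.comp measurable_snd).enorm.pow_const 2).mul
      (ENNReal.measurable_ofReal.comp (hφ.comp (measurable_fst.sub measurable_snd).norm))
  exact hm.lintegral_prod_right'

/-- Measurability of the weights `ofReal (θⁿ |v|)`. [folklore] -/
theorem measurable_ofReal_taoCutoff_pow_mul_norm (hv : Continuous v) (n : ℕ) :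
    Measurable fun x : ℝ³ => ENNReal.ofReal (taoCutoff R r x ^ n * ‖v x‖) :=
  ENNReal.measurable_ofReal.comp
    (((continuous_taoCutoff R r).pow n).mul hv.norm).measurable

/-- **The commutator term, `ℝ≥0∞` form (Tao's `X₅,₂`, corrected):**
`∫ θ|v|(x) ∫|k(x,y)| dy dx ≤ (2π)⁻¹ ‖v‖²_{L²} (‖θv‖_{L²} √(4π/(3r³)) + 6(C₁/r) ‖θ⁶v‖_{L⁶} ((20π/3)r^{3/5})^{5/6} + 15(C₁/r)² ‖θv‖_{L²} √(4πr))`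
(far part in `L² × L²`, near parts in `L⁶ × L^{6/5}` and `L² × L²`, Tonelli).
[cite: Tao2011, §8, proof of Lemma 8.1, `X₅,₂`] -/
theorem lintegral_weight_mul_commKernel_le (hv : Continuous v) (hr : 0 < r)
    (hC : ∀ x : ℝ³, ‖fderiv ℝ (taoCutoff R r) x‖ ≤ C₁ / r) (hC0 : 0 ≤ C₁ / r) :
    ∫⁻ x, ENNReal.ofReal (taoCutoff R r x * ‖v x‖) * ∫⁻ y, ‖commKernel R r v x y‖ₑ ≤
      ENNReal.ofReal (1 / (2 * Real.pi)) *
        ((∫⁻ x, ENNReal.ofReal (taoCutoff R r x * ‖v x‖) ^ 2) ^ (1 / 2 : ℝ) *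
              ENNReal.ofReal (Real.sqrt (4 * Real.pi / (3 * r ^ 3))) * (∫⁻ y, ‖v y‖ₑ ^ 2) +
          ENNReal.ofReal (6 * (C₁ / r)) *
            ((∫⁻ x, ENNReal.ofReal (taoCutoff R r x ^ 6 * ‖v x‖) ^ (6 : ℝ)) ^ (1 / 6 : ℝ) *
              ENNReal.ofReal ((20 * Real.pi / 3 * r ^ (3 / 5 : ℝ)) ^ (5 / 6 : ℝ)) *
                (∫⁻ y, ‖v y‖ₑ ^ 2)) +
          ENNReal.ofReal (15 * (C₁ / r) ^ 2) *
            ((∫⁻ x, ENNReal.ofReal (taoCutoff R r x * ‖v x‖) ^ 2) ^ (1 / 2 : ℝ) *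
              ENNReal.ofReal (Real.sqrt (4 * Real.pi * r)) * (∫⁻ y, ‖v y‖ₑ ^ 2))) := by
  set θ : ℝ³ → ℝ := taoCutoff R r with hθ
  have hF1 : Measurable fun x : ℝ³ => ENNReal.ofReal (θ x * ‖v x‖) := by
    have := measurable_ofReal_taoCutoff_pow_mul_norm (R := R) (r := r) hv 1
    simpa [hθ] using this
  have hF6 : Measurable fun x : ℝ³ => ENNReal.ofReal (θ x ^ 6 * ‖v x‖) :=
    measurable_ofReal_taoCutoff_pow_mul_norm hv 6
  have hJfar := measurable_lintegral_conv hv (measurable_farProfile r)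
  have hJ2 := measurable_lintegral_conv hv (measurable_nearProfile₂ r)
  have hJ1 := measurable_lintegral_conv hv (measurable_nearProfile₁ r)
  -- pointwise
  have hpt : ∀ x, ENNReal.ofReal (θ x * ‖v x‖) * ∫⁻ y, ‖commKernel R r v x y‖ₑ ≤
      ENNReal.ofReal (1 / (2 * Real.pi)) *
        (ENNReal.ofReal (θ x * ‖v x‖) * (∫⁻ y, ‖v y‖ₑ ^ 2 * ENNReal.ofReal (farProfile r ‖x - y‖)) +
          ENNReal.ofReal (6 * (C₁ / r)) * (ENNReal.ofReal (θ x ^ 6 * ‖v x‖) *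
            (∫⁻ y, ‖v y‖ₑ ^ 2 * ENNReal.ofReal (nearProfile₂ r ‖x - y‖))) +
          ENNReal.ofReal (15 * (C₁ / r) ^ 2) * (ENNReal.ofReal (θ x * ‖v x‖) *
            (∫⁻ y, ‖v y‖ₑ ^ 2 * ENNReal.ofReal (nearProfile₁ r ‖x - y‖)))) := by
    intro x
    have h := lintegral_enorm_commKernel_le (R := R) hv hC hC0 x
    have h6 : ENNReal.ofReal (θ x * ‖v x‖) * ENNReal.ofReal (6 * (C₁ / r) * taoCutoff R r x ^ 5) =
        ENNReal.ofReal (6 * (C₁ / r)) * ENNReal.ofReal (θ x ^ 6 * ‖v x‖) := by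
      have h0 : 0 ≤ θ x * ‖v x‖ := mul_nonneg (taoCutoff_nonneg R r x) (norm_nonneg _)
      rw [← ENNReal.ofReal_mul h0, ← ENNReal.ofReal_mul (by positivity)]
      congr 1
      rw [hθ]
      ring
    calc ENNReal.ofReal (θ x * ‖v x‖) * ∫⁻ y, ‖commKernel R r v x y‖ₑ
        ≤ ENNReal.ofReal (θ x * ‖v x‖) * (ENNReal.ofReal (1 / (2 * Real.pi)) *
          ((∫⁻ y, ‖v y‖ₑ ^ 2 * ENNReal.ofReal (farProfile r ‖x - y‖)) +
            ENNReal.ofReal (6 * (C₁ / r) * taoCutoff R r x ^ 5) *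
              (∫⁻ y, ‖v y‖ₑ ^ 2 * ENNReal.ofReal (nearProfile₂ r ‖x - y‖)) +
            ENNReal.ofReal (15 * (C₁ / r) ^ 2) *
              (∫⁻ y, ‖v y‖ₑ ^ 2 * ENNReal.ofReal (nearProfile₁ r ‖x - y‖)))) := by gcongr
      _ = _ := by
          rw [← mul_assoc (ENNReal.ofReal (6 * (C₁ / r))), ← h6]
          ring
  calc ∫⁻ x, ENNReal.ofReal (θ x * ‖v x‖) * ∫⁻ y, ‖commKernel R r v x y‖ₑ
      ≤ ∫⁻ x, ENNReal.ofReal (1 / (2 * Real.pi)) *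
        (ENNReal.ofReal (θ x * ‖v x‖) * (∫⁻ y, ‖v y‖ₑ ^ 2 * ENNReal.ofReal (farProfile r ‖x - y‖)) +
          ENNReal.ofReal (6 * (C₁ / r)) * (ENNReal.ofReal (θ x ^ 6 * ‖v x‖) *
            (∫⁻ y, ‖v y‖ₑ ^ 2 * ENNReal.ofReal (nearProfile₂ r ‖x - y‖))) +
          ENNReal.ofReal (15 * (C₁ / r) ^ 2) * (ENNReal.ofReal (θ x * ‖v x‖) *
            (∫⁻ y, ‖v y‖ₑ ^ 2 * ENNReal.ofReal (nearProfile₁ r ‖x - y‖)))) :=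
        lintegral_mono hpt
    _ = ENNReal.ofReal (1 / (2 * Real.pi)) *
        ((∫⁻ x, ENNReal.ofReal (θ x * ‖v x‖) *
            ∫⁻ y, ‖v y‖ₑ ^ 2 * ENNReal.ofReal (farProfile r ‖x - y‖)) +
          ENNReal.ofReal (6 * (C₁ / r)) * (∫⁻ x, ENNReal.ofReal (θ x ^ 6 * ‖v x‖) *
            ∫⁻ y, ‖v y‖ₑ ^ 2 * ENNReal.ofReal (nearProfile₂ r ‖x - y‖)) +
          ENNReal.ofReal (15 * (C₁ / r) ^ 2) * (∫⁻ x, ENNReal.ofReal (θ x * ‖v x‖) *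
            ∫⁻ y, ‖v y‖ₑ ^ 2 * ENNReal.ofReal (nearProfile₁ r ‖x - y‖))) := by
        have m1 : Measurable fun x => ENNReal.ofReal (θ x * ‖v x‖) *
            ∫⁻ y, ‖v y‖ₑ ^ 2 * ENNReal.ofReal (farProfile r ‖x - y‖) := hF1.mul hJfar
        have m2 : Measurable fun x => ENNReal.ofReal (θ x ^ 6 * ‖v x‖) *
            ∫⁻ y, ‖v y‖ₑ ^ 2 * ENNReal.ofReal (nearProfile₂ r ‖x - y‖) := hF6.mul hJ2
        have m3 : Measurable fun x => ENNReal.ofReal (θ x * ‖v x‖) *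
            ∫⁻ y, ‖v y‖ₑ ^ 2 * ENNReal.ofReal (nearProfile₁ r ‖x - y‖) := hF1.mul hJ1
        have m12 : Measurable fun x => ENNReal.ofReal (θ x * ‖v x‖) *
            (∫⁻ y, ‖v y‖ₑ ^ 2 * ENNReal.ofReal (farProfile r ‖x - y‖)) +
          ENNReal.ofReal (6 * (C₁ / r)) * (ENNReal.ofReal (θ x ^ 6 * ‖v x‖) *
            (∫⁻ y, ‖v y‖ₑ ^ 2 * ENNReal.ofReal (nearProfile₂ r ‖x - y‖))) :=
          m1.add (m2.const_mul _)
        rw [lintegral_const_mul' _ _ ENNReal.ofReal_ne_top, lintegral_add_left m12,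
          lintegral_add_left m1, lintegral_const_mul _ m2, lintegral_const_mul _ m3]
    _ ≤ _ := by
        gcongr
        · exact lintegral_mul_conv_le hv (measurable_farProfile r) hF1
            (lintegral_mul_farProfile_le hr hF1)
        · exact lintegral_mul_conv_le hv (measurable_nearProfile₂ r) hF6
            (lintegral_mul_nearProfile₂_le hr hF6)
        · exact lintegral_mul_conv_le hv (measurable_nearProfile₁ r) hF1
            (lintegral_mul_nearProfile₁_le hr hF1)

/-- `X Y Z ≤ ofReal (a b c)` from `X ≤ ofReal a`, `Y ≤ ofReal b`, `Z ≤ ofReal c` (`a, b ≥ 0`). [folklore] -/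
theorem mul_mul_le_ofReal {X Y Z : ℝ≥0∞} {a b c : ℝ} (ha : 0 ≤ a) (hb : 0 ≤ b)
    (hX : X ≤ ENNReal.ofReal a) (hY : Y ≤ ENNReal.ofReal b) (hZ : Z ≤ ENNReal.ofReal c) :
    X * Y * Z ≤ ENNReal.ofReal (a * b * c) := by
  calc X * Y * Z ≤ ENNReal.ofReal a * ENNReal.ofReal b * ENNReal.ofReal c := by gcongr
    _ = ENNReal.ofReal (a * b * c) := by
        rw [ENNReal.ofReal_mul (mul_nonneg ha hb), ENNReal.ofReal_mul ha]

/-- `ofReal κ · T ≤ ofReal (κ t)` from `T ≤ ofReal t` (`κ ≥ 0`). [folklore] -/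
theorem ofReal_mul_le_ofReal {T : ℝ≥0∞} {κ t : ℝ} (hκ : 0 ≤ κ) (hT : T ≤ ENNReal.ofReal t) :
    ENNReal.ofReal κ * T ≤ ENNReal.ofReal (κ * t) := by
  rw [ENNReal.ofReal_mul hκ]
  gcongr

/-- `X + Y + Z ≤ ofReal (a + b + c)` from the three bounds (`a, b, c ≥ 0`). [folklore] -/
theorem add_add_le_ofReal {X Y Z : ℝ≥0∞} {a b c : ℝ} (ha : 0 ≤ a) (hb : 0 ≤ b) (hc : 0 ≤ c)
    (hX : X ≤ ENNReal.ofReal a) (hY : Y ≤ ENNReal.ofReal b) (hZ : Z ≤ ENNReal.ofReal c) :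
    X + Y + Z ≤ ENNReal.ofReal (a + b + c) :=
  calc X + Y + Z ≤ ENNReal.ofReal a + ENNReal.ofReal b + ENNReal.ofReal c := by gcongr
    _ = ENNReal.ofReal (a + b + c) := by
        rw [ENNReal.ofReal_add (add_nonneg ha hb) hc, ENNReal.ofReal_add ha hb]

/-- `‖θ v‖_{L²} ≤ A` in `ℝ≥0∞` form: `(∫⁻ ofReal(θ|v|)²)^{1/2} ≤ ofReal A` when `∫⁻ ‖v‖ₑ² ≤ A²`.
[folklore] -/
theorem lintegral_ofReal_taoCutoff_mul_norm_sq_rpow_le {A : ℝ} (hA0 : 0 ≤ A)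
    (hA : ∫⁻ x, ‖v x‖ₑ ^ 2 ≤ ENNReal.ofReal (A ^ 2)) :
    (∫⁻ x, ENNReal.ofReal (taoCutoff R r x * ‖v x‖) ^ 2) ^ (1 / 2 : ℝ) ≤ ENNReal.ofReal A := by
  have h1 : ∫⁻ x, ENNReal.ofReal (taoCutoff R r x * ‖v x‖) ^ 2 ≤ ENNReal.ofReal (A ^ 2) := by
    refine (lintegral_mono fun x => ?_).trans hA
    rw [← ofReal_norm (v x)]
    gcongr
    exact mul_le_of_le_one_left (norm_nonneg _) (taoCutoff_le_one R r x)
  calc (∫⁻ x, ENNReal.ofReal (taoCutoff R r x * ‖v x‖) ^ 2) ^ (1 / 2 : ℝ)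
      ≤ ENNReal.ofReal (A ^ 2) ^ (1 / 2 : ℝ) := by gcongr
    _ = ENNReal.ofReal A := by
        rw [ENNReal.ofReal_rpow_of_nonneg (sq_nonneg A) (by norm_num), ← Real.sqrt_eq_rpow,
          Real.sqrt_sq hA0]

/-- **The commutator term, real form of the bound:** with `∫|v|² ≤ A²` and
`‖θ⁶ v‖_{L⁶} ≤ s`,
`∫ θ|v|(x) ∫|k(x,y)| dy dx ≤ (2π)⁻¹ (A √(4π/(3r³)) A² + 6(C₁/r)(s ((20π/3)r^{3/5})^{5/6} A²) + 15(C₁/r)² (A √(4πr) A²))`.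
[cite: Tao2011, §8, proof of Lemma 8.1, `X₅,₂`] -/
theorem lintegral_weight_mul_commKernel_le_ofReal (hv : Continuous v) (hr : 0 < r)
    (hC : ∀ x : ℝ³, ‖fderiv ℝ (taoCutoff R r) x‖ ≤ C₁ / r) (hC0 : 0 ≤ C₁ / r) {A s : ℝ}
    (hA0 : 0 ≤ A) (hs0 : 0 ≤ s) (hA : ∫⁻ x, ‖v x‖ₑ ^ 2 ≤ ENNReal.ofReal (A ^ 2))
    (hs : (∫⁻ x, ENNReal.ofReal (taoCutoff R r x ^ 6 * ‖v x‖) ^ (6 : ℝ)) ^ (1 / 6 : ℝ) ≤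
      ENNReal.ofReal s) :
    ∫⁻ x, ENNReal.ofReal (taoCutoff R r x * ‖v x‖) * ∫⁻ y, ‖commKernel R r v x y‖ₑ ≤
      ENNReal.ofReal (1 / (2 * Real.pi) *
        (A * Real.sqrt (4 * Real.pi / (3 * r ^ 3)) * A ^ 2 +
          6 * (C₁ / r) * (s * (20 * Real.pi / 3 * r ^ (3 / 5 : ℝ)) ^ (5 / 6 : ℝ) * A ^ 2) +
          15 * (C₁ / r) ^ 2 * (A * Real.sqrt (4 * Real.pi * r) * A ^ 2))) := by
  have h2 := lintegral_ofReal_taoCutoff_mul_norm_sq_rpow_le (R := R) (r := r) hA0 hA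
  refine (lintegral_weight_mul_commKernel_le hv hr hC hC0).trans ?_
  refine ofReal_mul_le_ofReal (by positivity)
    (add_add_le_ofReal (by positivity) (by positivity) (by positivity) ?_ ?_ ?_)
  · exact mul_mul_le_ofReal hA0 (Real.sqrt_nonneg _) h2 le_rfl hA
  · exact ofReal_mul_le_ofReal (by positivity) (mul_mul_le_ofReal hs0 (by positivity) hs le_rfl hA)
  · exact ofReal_mul_le_ofReal (by positivity)
      (mul_mul_le_ofReal hA0 (Real.sqrt_nonneg _) h2 le_rfl hA)

/-- Numerical simplification of the commutator bound (`2 ≤ π ≤ 4`): with `ρ = √r`,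
`(2π)⁻¹ (3-term sum) ≤ A³/(rρ) + 41 C₁ A² s ρ/r + 15 C₁² A³ ρ/r²`. [folklore] -/
theorem comm_raw_le {A s : ℝ} (hA0 : 0 ≤ A) (hs0 : 0 ≤ s) (hC0 : 0 ≤ C₁) (hr : 0 < r) :
    1 / (2 * Real.pi) *
        (A * Real.sqrt (4 * Real.pi / (3 * r ^ 3)) * A ^ 2 +
          6 * (C₁ / r) * (s * (20 * Real.pi / 3 * r ^ (3 / 5 : ℝ)) ^ (5 / 6 : ℝ) * A ^ 2) +
          15 * (C₁ / r) ^ 2 * (A * Real.sqrt (4 * Real.pi * r) * A ^ 2)) ≤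
      A ^ 3 / (r * Real.sqrt r) + 41 * C₁ * A ^ 2 * s * Real.sqrt r / r +
        15 * C₁ ^ 2 * A ^ 3 * Real.sqrt r / r ^ 2 := by
  have hπ0 : 0 < Real.pi := Real.pi_pos
  have hπ2 : 2 ≤ Real.pi := Real.two_le_pi
  have hπ4 : Real.pi ≤ 4 := Real.pi_le_four
  set ρ := Real.sqrt r with hρ
  have hρ0 : 0 < ρ := Real.sqrt_pos.2 hr
  have hρ2 : ρ ^ 2 = r := Real.sq_sqrt hr.le
  -- the three kernel constants
  have k1 : Real.sqrt (4 * Real.pi / (3 * r ^ 3)) ≤ 3 / (r * ρ) := by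
    rw [Real.sqrt_le_left (by positivity)]
    rw [div_pow, mul_pow, hρ2, div_le_div_iff₀ (by positivity) (by positivity)]
    nlinarith [pow_pos hr 3]
  have k2 : (20 * Real.pi / 3 * r ^ (3 / 5 : ℝ)) ^ (5 / 6 : ℝ) ≤ 27 * ρ := by
    rw [Real.mul_rpow (by positivity) (Real.rpow_nonneg hr.le _), ← Real.rpow_mul hr.le,
      show (3 / 5 : ℝ) * (5 / 6) = 1 / 2 by norm_num, ← Real.sqrt_eq_rpow, ← hρ]
    refine mul_le_mul_of_nonneg_right ?_ hρ0.le
    have h1 : (1 : ℝ) ≤ 20 * Real.pi / 3 := by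
      rw [le_div_iff₀ (by norm_num)]
      linarith
    calc (20 * Real.pi / 3) ^ (5 / 6 : ℝ) ≤ (20 * Real.pi / 3) ^ (1 : ℝ) :=
          Real.rpow_le_rpow_of_exponent_le h1 (by norm_num)
      _ = 20 * Real.pi / 3 := Real.rpow_one _
      _ ≤ 27 := by
          rw [div_le_iff₀ (by norm_num)]
          linarith
  have k3 : Real.sqrt (4 * Real.pi * r) ≤ 4 * ρ := by
    rw [Real.sqrt_le_left (by positivity), mul_pow, hρ2]
    nlinarith
  have k0 : 1 / (2 * Real.pi) ≤ 1 / 4 := by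
    rw [div_le_div_iff₀ (by positivity) (by norm_num)]
    linarith
  have hS0 : 0 ≤ A * Real.sqrt (4 * Real.pi / (3 * r ^ 3)) * A ^ 2 +
      6 * (C₁ / r) * (s * (20 * Real.pi / 3 * r ^ (3 / 5 : ℝ)) ^ (5 / 6 : ℝ) * A ^ 2) +
      15 * (C₁ / r) ^ 2 * (A * Real.sqrt (4 * Real.pi * r) * A ^ 2) := by positivity
  calc 1 / (2 * Real.pi) *
        (A * Real.sqrt (4 * Real.pi / (3 * r ^ 3)) * A ^ 2 +
          6 * (C₁ / r) * (s * (20 * Real.pi / 3 * r ^ (3 / 5 : ℝ)) ^ (5 / 6 : ℝ) * A ^ 2) +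
          15 * (C₁ / r) ^ 2 * (A * Real.sqrt (4 * Real.pi * r) * A ^ 2))
      ≤ 1 / 4 * (A * (3 / (r * ρ)) * A ^ 2 + 6 * (C₁ / r) * (s * (27 * ρ) * A ^ 2) +
          15 * (C₁ / r) ^ 2 * (A * (4 * ρ) * A ^ 2)) := by
        gcongr
    _ = 3 / 4 * (A ^ 3 / (r * ρ)) + 81 / 2 * (C₁ * A ^ 2 * s * ρ / r) +
          15 * C₁ ^ 2 * A ^ 3 * ρ / r ^ 2 := by
        field_simp
        ring
    _ ≤ A ^ 3 / (r * ρ) + 41 * C₁ * A ^ 2 * s * ρ / r + 15 * C₁ ^ 2 * A ^ 3 * ρ / r ^ 2 := by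
        have h1 : 0 ≤ A ^ 3 / (r * ρ) := by positivity
        have h2 : 0 ≤ C₁ * A ^ 2 * s * ρ / r := by positivity
        rw [show (41 : ℝ) * C₁ * A ^ 2 * s * ρ / r = 41 * (C₁ * A ^ 2 * s * ρ / r) by ring]
        linarith

/-- The weight of the pressure pairing: `D(θ⁸)(x) u = 8 θ⁷(x) Dθ(x) u = θ⁶(x) · (8 θ(x) Dθ(x) u)`.
[folklore] -/
theorem fderiv_taoCutoff_pow_eight_apply (x u : ℝ³) :
    fderiv ℝ (fun y => taoCutoff R r y ^ 8) x u =
      taoCutoff R r x ^ 6 * (8 * taoCutoff R r x * fderiv ℝ (taoCutoff R r) x u) := by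
  have hd : DifferentiableAt ℝ (taoCutoff (E := ℝ³) R r) x :=
    ((contDiff_taoCutoff (n := 1) R r).differentiable one_ne_zero) x
  rw [fderiv_fun_pow 8 hd]
  simp only [nsmul_eq_mul, FunLike.coe_smul, Pi.smul_apply, smul_eq_mul]
  norm_num
  ring

/-- The reduced weight `g(x) = 8 θ(x) Dθ(x)(v(x))` is continuous. [folklore] -/
theorem continuous_pressureWeight (hv : Continuous v) :
    Continuous fun x => 8 * taoCutoff R r x * fderiv ℝ (taoCutoff R r) x (v x) :=
  (continuous_const.mul (continuous_taoCutoff R r)).mul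
    (((contDiff_taoCutoff (n := 1) R r).continuous_fderiv one_ne_zero).clm_apply hv)

/-- `|g(x)| ≤ 8 (C₁/r) θ(x) |v(x)|`. [folklore] -/
theorem abs_pressureWeight_le (hC : ∀ x : ℝ³, ‖fderiv ℝ (taoCutoff R r) x‖ ≤ C₁ / r) (x : ℝ³) :
    |8 * taoCutoff R r x * fderiv ℝ (taoCutoff R r) x (v x)| ≤
      8 * (C₁ / r) * (taoCutoff R r x * ‖v x‖) := by
  have hθ := taoCutoff_nonneg R r x
  rw [abs_mul, abs_of_nonneg (by positivity : (0 : ℝ) ≤ 8 * taoCutoff R r x)]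
  have h1 : |fderiv ℝ (taoCutoff R r) x (v x)| ≤ C₁ / r * ‖v x‖ :=
    (Real.norm_eq_abs _ ▸ (fderiv ℝ (taoCutoff R r) x).le_opNorm (v x)).trans
      (mul_le_mul_of_nonneg_right (hC x) (norm_nonneg _))
  calc 8 * taoCutoff R r x * |fderiv ℝ (taoCutoff R r) x (v x)|
      ≤ 8 * taoCutoff R r x * (C₁ / r * ‖v x‖) := by gcongr
    _ = 8 * (C₁ / r) * (taoCutoff R r x * ‖v x‖) := by ring

/-- The reduced weight is square integrable with `∫ g² ≤ 64 (C₁/r)² A²`. [folklore] -/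
theorem integral_pressureWeight_sq_le (hv : Continuous v) (hv2 : Integrable fun x => ‖v x‖ ^ 2)
    {A : ℝ} (hA : ∫ x, ‖v x‖ ^ 2 ≤ A ^ 2)
    (hC : ∀ x : ℝ³, ‖fderiv ℝ (taoCutoff R r) x‖ ≤ C₁ / r) :
    Integrable (fun x => (8 * taoCutoff R r x * fderiv ℝ (taoCutoff R r) x (v x)) ^ 2) ∧
      ∫ x, (8 * taoCutoff R r x * fderiv ℝ (taoCutoff R r) x (v x)) ^ 2 ≤
        64 * (C₁ / r) ^ 2 * A ^ 2 := by
  have hpt : ∀ x, (8 * taoCutoff R r x * fderiv ℝ (taoCutoff R r) x (v x)) ^ 2 ≤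
      64 * (C₁ / r) ^ 2 * ‖v x‖ ^ 2 := by
    intro x
    have h := abs_pressureWeight_le (v := v) hC x
    have hθ0 := taoCutoff_nonneg R r x
    have hθ1 := taoCutoff_le_one R r x
    have h2 : 8 * (C₁ / r) * (taoCutoff R r x * ‖v x‖) ≤ 8 * (C₁ / r) * ‖v x‖ := by
      have hC0 : 0 ≤ C₁ / r := le_trans (norm_nonneg _) (hC x)
      exact mul_le_mul_of_nonneg_left (mul_le_of_le_one_left (norm_nonneg _) hθ1) (by positivity)
    calc (8 * taoCutoff R r x * fderiv ℝ (taoCutoff R r) x (v x)) ^ 2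
        = |8 * taoCutoff R r x * fderiv ℝ (taoCutoff R r) x (v x)| ^ 2 := (sq_abs _).symm
      _ ≤ (8 * (C₁ / r) * ‖v x‖) ^ 2 := pow_le_pow_left₀ (abs_nonneg _) (h.trans h2) 2
      _ = 64 * (C₁ / r) ^ 2 * ‖v x‖ ^ 2 := by ring
  have hint : Integrable (fun x => (8 * taoCutoff R r x * fderiv ℝ (taoCutoff R r) x (v x)) ^ 2) :=
    (hv2.const_mul (64 * (C₁ / r) ^ 2)).mono'
      ((continuous_pressureWeight hv).pow 2).aestronglyMeasurable
      (Eventually.of_forall fun x => by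
        rw [Real.norm_eq_abs, abs_of_nonneg (sq_nonneg _)]
        exact hpt x)
  refine ⟨hint, ?_⟩
  calc ∫ x, (8 * taoCutoff R r x * fderiv ℝ (taoCutoff R r) x (v x)) ^ 2
      ≤ ∫ x, 64 * (C₁ / r) ^ 2 * ‖v x‖ ^ 2 := integral_mono hint (hv2.const_mul _) hpt
    _ = 64 * (C₁ / r) ^ 2 * ∫ x, ‖v x‖ ^ 2 := integral_const_mul _ _
    _ ≤ 64 * (C₁ / r) ^ 2 * A ^ 2 := by gcongr

/-- **The commutator part of the pressure pairing (`X₅,₂`):** the pairing of the commutator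
`∫ k(·, y) dy` with the weight `g = 8 θ Dθ(v)` is absolutely convergent and
`|∫ (∫ k(x,y) dy) g(x) dx| ≤ 8 (C₁/r) (A³/(r√r) + 41 C₁ A² s √r/r + 15 C₁² A³ √r/r²)`
(`∫|v|² ≤ A²`, `‖θ⁶v‖_{L⁶} ≤ s`). [cite: Tao2011, §8, proof of Lemma 8.1, `X₅,₂`] -/
theorem commutator_pairing_le (hv : Continuous v) (hr : 0 < r)
    (hC : ∀ x : ℝ³, ‖fderiv ℝ (taoCutoff R r) x‖ ≤ C₁ / r) (hC0 : 0 ≤ C₁) {A s : ℝ}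
    (hA0 : 0 ≤ A) (hs0 : 0 ≤ s) (hA : ∫⁻ x, ‖v x‖ₑ ^ 2 ≤ ENNReal.ofReal (A ^ 2))
    (hs : (∫⁻ x, ENNReal.ofReal (taoCutoff R r x ^ 6 * ‖v x‖) ^ (6 : ℝ)) ^ (1 / 6 : ℝ) ≤
      ENNReal.ofReal s) :
    Integrable (fun x => (∫ y, commKernel R r v x y) *
        (8 * taoCutoff R r x * fderiv ℝ (taoCutoff R r) x (v x))) ∧
      |∫ x, (∫ y, commKernel R r v x y) * (8 * taoCutoff R r x * fderiv ℝ (taoCutoff R r) x (v x))| ≤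
        8 * (C₁ / r) * (A ^ 3 / (r * Real.sqrt r) + 41 * C₁ * A ^ 2 * s * Real.sqrt r / r +
          15 * C₁ ^ 2 * A ^ 3 * Real.sqrt r / r ^ 2) := by
  have hCr : 0 ≤ C₁ / r := div_nonneg hC0 hr.le
  set G : ℝ³ → ℝ := fun x => (∫ y, commKernel R r v x y) *
    (8 * taoCutoff R r x * fderiv ℝ (taoCutoff R r) x (v x)) with hG
  set B : ℝ := A ^ 3 / (r * Real.sqrt r) + 41 * C₁ * A ^ 2 * s * Real.sqrt r / r +
    15 * C₁ ^ 2 * A ^ 3 * Real.sqrt r / r ^ 2 with hB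
  have hB0 : 0 ≤ B := by positivity
  have hGm : AEStronglyMeasurable G volume :=
    (stronglyMeasurable_integral_commKernel (R := R) (r := r) hv).aestronglyMeasurable.mul
      (continuous_pressureWeight hv).aestronglyMeasurable
  -- pointwise bound in `ℝ≥0∞`
  have hpt : ∀ x, ‖G x‖ₑ ≤ ENNReal.ofReal (8 * (C₁ / r)) *
      (ENNReal.ofReal (taoCutoff R r x * ‖v x‖) * ∫⁻ y, ‖commKernel R r v x y‖ₑ) := by
    intro x
    have hθv : 0 ≤ taoCutoff R r x * ‖v x‖ := mul_nonneg (taoCutoff_nonneg R r x) (norm_nonneg _)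
    calc ‖G x‖ₑ = ‖∫ y, commKernel R r v x y‖ₑ *
          ‖8 * taoCutoff R r x * fderiv ℝ (taoCutoff R r) x (v x)‖ₑ := enorm_mul _ _
      _ ≤ (∫⁻ y, ‖commKernel R r v x y‖ₑ) *
          ENNReal.ofReal (8 * (C₁ / r) * (taoCutoff R r x * ‖v x‖)) := by
          refine mul_le_mul' (enorm_integral_le_lintegral_enorm _) ?_
          rw [← ofReal_norm, Real.norm_eq_abs]
          exact ENNReal.ofReal_le_ofReal (abs_pressureWeight_le hC x)
      _ = _ := by
          rw [ENNReal.ofReal_mul (by positivity)]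
          ring
  have hlin : ∫⁻ x, ‖G x‖ₑ ≤ ENNReal.ofReal (8 * (C₁ / r) * B) := by
    calc ∫⁻ x, ‖G x‖ₑ ≤ ∫⁻ x, ENNReal.ofReal (8 * (C₁ / r)) *
          (ENNReal.ofReal (taoCutoff R r x * ‖v x‖) * ∫⁻ y, ‖commKernel R r v x y‖ₑ) :=
          lintegral_mono hpt
      _ = ENNReal.ofReal (8 * (C₁ / r)) *
          ∫⁻ x, ENNReal.ofReal (taoCutoff R r x * ‖v x‖) * ∫⁻ y, ‖commKernel R r v x y‖ₑ :=
          lintegral_const_mul' _ _ ENNReal.ofReal_ne_top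
      _ ≤ ENNReal.ofReal (8 * (C₁ / r)) * ENNReal.ofReal B := by
          gcongr
          exact (lintegral_weight_mul_commKernel_le_ofReal hv hr hC hCr hA0 hs0 hA hs).trans
            (ENNReal.ofReal_le_ofReal (comm_raw_le hA0 hs0 hC0 hr))
      _ = ENNReal.ofReal (8 * (C₁ / r) * B) := (ENNReal.ofReal_mul (by positivity)).symm
  have hGi : Integrable G :=
    ⟨hGm, (hasFiniteIntegral_iff_enorm.2 (lt_of_le_of_lt hlin ENNReal.ofReal_lt_top))⟩
  refine ⟨hGi, ?_⟩
  calc |∫ x, G x| = ‖∫ x, G x‖ := (Real.norm_eq_abs _).symm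
    _ ≤ (∫⁻ x, ENNReal.ofReal ‖G x‖).toReal := norm_integral_le_lintegral_norm G
    _ = (∫⁻ x, ‖G x‖ₑ).toReal := by simp_rw [ofReal_norm]
    _ ≤ 8 * (C₁ / r) * B := ENNReal.toReal_le_of_le_ofReal (by positivity) hlin

end CommutatorBound

/-! ## The named fact: `L²` boundedness of the Riesz-type singular integrals behind `p̃` -/

/-- **Stein 1970, Ch. II §4.2 Theorem 3 (with §4.5 Theorem 4 (a)), applied to the normalised
pressure (nothing asserted).** Printed: for `Ω` homogeneous of degree `0` with
`∫_{S^{n-1}} Ω dσ = 0` and a Dini modulus of continuity on the sphere (e.g. `Ω ∈ C¹`), and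
`f ∈ L^p(ℝⁿ)`, `1 < p < ∞`, the truncated singular integrals
`T_ε f(x) = ∫_{|y|≥ε} Ω(y)|y|⁻ⁿ f(x - y) dy` satisfy `‖T_ε f‖_p ≤ A_p ‖f‖_p`, converge in `L^p` to
`T f` with `‖T f‖_p ≤ A_p ‖f‖_p` (Thm 3 (a)–(b)), and converge almost everywhere (Thm 4 (a)).
Rendering for `NS.normalisedPressure` on `ℝ³` (`p = 2`): for `w ∈ C^∞_c(ℝ³; ℝ³)`,
`p̃[w](x) = -|w(x)|²/3 + lim_{ε→0} Σᵢⱼ ∫_{|x-y|>ε} Kᵢⱼ(x-y) wᵢ(y)wⱼ(y) dy` with the nine kernels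
`Kᵢⱼ(z) = (3zᵢzⱼ - δᵢⱼ|z|²)/(4π|z|⁵) = Ωᵢⱼ(z)/|z|³`, `Ωᵢⱼ` smooth on `S²` with mean zero, and
`wᵢwⱼ ∈ L²`; so at almost every `x` the principal value in the definition of `normalisedPressure`
exists and equals the `L²` limit, whence `p̃[w]` is (a.e. equal to) an `L²` function with
`‖p̃[w]‖_{L²} ≤ (1/3 + 9A₂) ‖|w|²‖_{L²}`: there is an absolute constant `C` with
`p̃[w] ∈ L²` and `‖p̃[w]‖_{L²} ≤ C ‖|w|²‖_{L²}` for all `w ∈ C^∞_c` (the class used downstream: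
`w = θ³ v` with `v` smooth; Stein's statement covers all `wᵢwⱼ ∈ L²`). This is the input "the
singular integral `Δ⁻¹∇²` is bounded on `L²`" of Tao 2011, §8, estimate of `X₅,₁`. Its proof
(next layer) is either Stein's (Calderón–Zygmund) or Plancherel, or the Newtonian-potential
identity `‖D²(Γ * g)‖_{L²} = ‖g‖_{L²}`; Mathlib has none of these at this pin.
[cite: Stein1971, Ch. II §4.2 Thm 3] -/
def stein1970_normalisedPressure_eLpNorm_le : Prop :=
  ∃ C : ℝ, 0 ≤ C ∧ ∀ w : ℝ³ → ℝ³, ContDiff ℝ ∞ w → HasCompactSupport w →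
    MemLp (normalisedPressure w) 2 volume ∧
      eLpNorm (normalisedPressure w) 2 volume ≤
        ENNReal.ofReal C * eLpNorm (fun x => ‖w x‖ ^ 2) 2 volume

/-! ## The direct term `X₅,₁ = ∫ p̃[θ³v] g` -/

section DirectTerm

variable {R r C₁ A : ℝ} {v : ℝ³ → ℝ³}

/-- `∫ θ¹² |v|⁴ ≤ A √(∫ |θ⁴ v|⁶)` (Cauchy–Schwarz: `θ¹²|v|⁴ = |v| · θ¹²|v|³`; Tao:
"`‖(uη^{3/2})²‖_{L²} ≲ ‖u‖^{1/2}_{L²} ‖uη²‖^{3/2}_{L⁶}`"). [cite: Tao2011, §8, proof of Lemma 8.1, `X₅,₁`] -/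
theorem integral_taoCutoff_pow_twelve_mul_norm_pow_four_le (hv : Continuous v)
    (hv2 : Integrable fun x => ‖v x‖ ^ 2) (hA : ∫ x, ‖v x‖ ^ 2 ≤ A ^ 2) (hA0 : 0 ≤ A)
    (hr : 0 ≤ r) (hR : 0 ≤ R) :
    Integrable (fun x => ‖taoCutoff R r x ^ 3 • v x‖ ^ 4) ∧
      ∫ x, ‖taoCutoff R r x ^ 3 • v x‖ ^ 4 ≤
        A * Real.sqrt (∫ x, ‖taoCutoff R r x ^ 4 • v x‖ ^ 6) := by
  set θ : ℝ³ → ℝ := taoCutoff R r with hθ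
  have hθc : Continuous θ := continuous_taoCutoff R r
  have key4 : ∀ x, ‖θ x ^ 3 • v x‖ ^ 4 = ‖v x‖ * (θ x ^ 12 * ‖v x‖ ^ 3) := fun x => by
    rw [norm_smul, Real.norm_eq_abs, abs_of_nonneg (taoCutoff_pow_nonneg R r x 3)]
    ring
  have key6 : ∀ x, (θ x ^ 12 * ‖v x‖ ^ 3) ^ 2 = ‖θ x ^ 4 • v x‖ ^ 6 := fun x => by
    rw [norm_smul, Real.norm_eq_abs, abs_of_nonneg (taoCutoff_pow_nonneg R r x 4)]
    ring
  have hi4 : Integrable (fun x => ‖θ x ^ 3 • v x‖ ^ 4) := by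
    have : (fun x => ‖θ x ^ 3 • v x‖ ^ 4) = fun x => θ x ^ 12 * ‖v x‖ ^ 4 := by
      funext x
      rw [norm_smul, Real.norm_eq_abs, abs_of_nonneg (taoCutoff_pow_nonneg R r x 3)]
      ring
    rw [this]
    exact integrable_taoCutoff_pow_mul (by norm_num) hr hR (hv.norm.pow 4)
  have hi6 : Integrable (fun x => (θ x ^ 12 * ‖v x‖ ^ 3) ^ 2) := by
    have : (fun x => (θ x ^ 12 * ‖v x‖ ^ 3) ^ 2) = fun x => θ x ^ 24 * ‖v x‖ ^ 6 := by
      funext x; ring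
    rw [this]
    exact integrable_taoCutoff_pow_mul (by norm_num) hr hR (hv.norm.pow 6)
  refine ⟨hi4, ?_⟩
  calc ∫ x, ‖θ x ^ 3 • v x‖ ^ 4 = ∫ x, ‖v x‖ * (θ x ^ 12 * ‖v x‖ ^ 3) :=
        integral_congr_ae (Eventually.of_forall key4)
    _ ≤ Real.sqrt (∫ x, ‖v x‖ ^ 2) * Real.sqrt (∫ x, (θ x ^ 12 * ‖v x‖ ^ 3) ^ 2) :=
        integral_mul_le_sqrt_mul_sqrt (fun x => norm_nonneg _)
          (fun x => mul_nonneg (taoCutoff_pow_nonneg R r x 12) (by positivity))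
          hv.norm.aestronglyMeasurable
          ((hθc.pow 12).mul (hv.norm.pow 3)).aestronglyMeasurable hv2 hi6
    _ ≤ A * Real.sqrt (∫ x, ‖θ x ^ 4 • v x‖ ^ 6) := by
        have h1 : Real.sqrt (∫ x, ‖v x‖ ^ 2) ≤ A := by
          rw [Real.sqrt_le_left hA0]
          exact hA
        have h2 : (∫ x, (θ x ^ 12 * ‖v x‖ ^ 3) ^ 2) = ∫ x, ‖θ x ^ 4 • v x‖ ^ 6 :=
          integral_congr_ae (Eventually.of_forall key6)
        rw [h2]
        exact mul_le_mul_of_nonneg_right h1 (Real.sqrt_nonneg _)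

/-- From the `L²` bound of the fact to real integrals: `∫ p̃[w]² ≤ C² ∫ |w|⁴` and `p̃[w]²`
integrable, for continuous compactly supported `w`. [cite: Stein1971, Ch. II §4.2 Thm 3] -/
theorem integral_normalisedPressure_sq_le {C : ℝ} (hC0 : 0 ≤ C) {w : ℝ³ → ℝ³}
    (hmem : MemLp (normalisedPressure w) 2 volume)
    (hle : eLpNorm (normalisedPressure w) 2 volume ≤
      ENNReal.ofReal C * eLpNorm (fun x => ‖w x‖ ^ 2) 2 volume)
    (hw : Continuous w) (hwc : HasCompactSupport w) :
    Integrable (fun x => normalisedPressure w x ^ 2) ∧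
      Real.sqrt (∫ x, normalisedPressure w x ^ 2) ≤ C * Real.sqrt (∫ x, ‖w x‖ ^ 4) := by
  have hint : Integrable (fun x => normalisedPressure w x ^ 2) :=
    (memLp_two_iff_integrable_sq hmem.1).1 hmem
  refine ⟨hint, ?_⟩
  have hcs : HasCompactSupport (fun x => ‖w x‖ ^ 2) :=
    hwc.norm.comp_left (g := fun t : ℝ => t ^ 2) (by norm_num)
  have hw2 : MemLp (fun x => ‖w x‖ ^ 2) ((2 : ℕ) : ℝ≥0∞) volume :=
    Continuous.memLp_of_hasCompactSupport (by fun_prop) hcs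
  have hmem' : MemLp (normalisedPressure w) ((2 : ℕ) : ℝ≥0∞) volume := by
    rw [Nat.cast_ofNat]; exact hmem
  have h1 := eLpNorm_natCast_eq_ofReal (n := 2) two_ne_zero hmem'
  have h2 := eLpNorm_natCast_eq_ofReal (n := 2) two_ne_zero hw2
  rw [Nat.cast_ofNat] at h1 h2
  rw [h1, h2, ← ENNReal.ofReal_mul hC0, ENNReal.ofReal_le_ofReal_iff (by positivity)] at hle
  simp only [Real.norm_eq_abs, sq_abs, Nat.cast_ofNat] at hle
  rw [show ((2 : ℝ))⁻¹ = 1 / 2 by norm_num, ← Real.sqrt_eq_rpow, ← Real.sqrt_eq_rpow] at hle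
  have h4 : (fun x => (‖w x‖ ^ 2) ^ 2) = fun x => ‖w x‖ ^ 4 := by
    funext x
    ring
  rw [h4] at hle
  exact hle

/-- **The direct term `X₅,₁` (Tao: "`X₅,₁ ≲ r⁻¹ ‖u‖_{L²} ‖Δ⁻¹∇²(u u η³)‖_{L²}`, then the `L²`
boundedness of `Δ⁻¹∇²`, Hölder and Sobolev").** With `w = θ³v`, the weight `g = 8θDθ(v)`,
`∫|v|² ≤ A²` and the `L²` bound `‖p̃[w]‖_{L²} ≤ C_R ‖|w|²‖_{L²}`: the pairing `∫ p̃[w] g` is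
absolutely convergent and `|∫ p̃[w] g| ≤ 8 (C₁/r) A · C_R √(A √(∫|θ⁴v|⁶))`.
[cite: Tao2011, §8, proof of Lemma 8.1, `X₅,₁`] -/
theorem direct_pairing_le {C_R : ℝ} (hCR0 : 0 ≤ C_R)
    (hRz : ∀ w : ℝ³ → ℝ³, ContDiff ℝ ∞ w → HasCompactSupport w →
      MemLp (normalisedPressure w) 2 volume ∧
        eLpNorm (normalisedPressure w) 2 volume ≤
          ENNReal.ofReal C_R * eLpNorm (fun x => ‖w x‖ ^ 2) 2 volume)
    (hv : ContDiff ℝ ∞ v) (hv2 : Integrable fun x => ‖v x‖ ^ 2) (hA : ∫ x, ‖v x‖ ^ 2 ≤ A ^ 2)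
    (hA0 : 0 ≤ A) (hr : 0 < r) (hR : 0 < R)
    (hC : ∀ x : ℝ³, ‖fderiv ℝ (taoCutoff R r) x‖ ≤ C₁ / r) (hC0 : 0 ≤ C₁) :
    Integrable (fun x => normalisedPressure (fun y => taoCutoff R r y ^ 3 • v y) x *
        (8 * taoCutoff R r x * fderiv ℝ (taoCutoff R r) x (v x))) ∧
      |∫ x, normalisedPressure (fun y => taoCutoff R r y ^ 3 • v y) x *
          (8 * taoCutoff R r x * fderiv ℝ (taoCutoff R r) x (v x))| ≤
        8 * (C₁ / r) * A *
          (C_R * Real.sqrt (A * Real.sqrt (∫ x, ‖taoCutoff R r x ^ 4 • v x‖ ^ 6))) := by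
  set θ : ℝ³ → ℝ := taoCutoff R r with hθ
  set w : ℝ³ → ℝ³ := fun y => θ y ^ 3 • v y with hw
  set g : ℝ³ → ℝ := fun x => 8 * θ x * fderiv ℝ θ x (v x) with hg
  have hw1 : ContDiff ℝ ∞ w := (contDiff_taoCutoff_pow R r 3).smul hv
  have hwc : HasCompactSupport w :=
    (hasCompactSupport_taoCutoff_pow hR.le hr.le (by norm_num : (3 : ℕ) ≠ 0)).smul_right
  obtain ⟨hmem, hle⟩ := hRz w hw1 hwc
  obtain ⟨hp2, hpw⟩ := integral_normalisedPressure_sq_le hCR0 hmem hle hw1.continuous hwc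
  obtain ⟨hw4, hw4le⟩ := integral_taoCutoff_pow_twelve_mul_norm_pow_four_le hv.continuous hv2 hA
    hA0 hr.le hR.le
  obtain ⟨hg2, hg2le⟩ := integral_pressureWeight_sq_le (R := R) hv.continuous hv2 hA hC
  have hgc : Continuous g := continuous_pressureWeight hv.continuous
  have hgmem : MemLp g 2 volume := (memLp_two_iff_integrable_sq hgc.aestronglyMeasurable).2 hg2
  have hint : Integrable (fun x => normalisedPressure w x * g x) := hmem.integrable_mul hgmem
  refine ⟨hint, ?_⟩
  -- Cauchy–Schwarz
  have hCS : ∫ x, |normalisedPressure w x| * |g x| ≤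
      Real.sqrt (∫ x, normalisedPressure w x ^ 2) * Real.sqrt (∫ x, g x ^ 2) := by
    have h := integral_mul_le_sqrt_mul_sqrt (μ := volume) (f := fun x => |normalisedPressure w x|)
      (g := fun x => |g x|) (fun x => abs_nonneg _) (fun x => abs_nonneg _)
      hmem.1.norm hgc.aestronglyMeasurable.norm (by simpa only [sq_abs] using hp2)
      (by simpa only [sq_abs] using hg2)
    simpa only [sq_abs] using h
  have hsq : Real.sqrt (∫ x, g x ^ 2) ≤ 8 * (C₁ / r) * A := by
    rw [Real.sqrt_le_left (by positivity)]
    calc ∫ x, g x ^ 2 ≤ 64 * (C₁ / r) ^ 2 * A ^ 2 := hg2le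
      _ = (8 * (C₁ / r) * A) ^ 2 := by ring
  calc |∫ x, normalisedPressure w x * g x| ≤ ∫ x, |normalisedPressure w x * g x| :=
        abs_integral_le_integral_abs
    _ = ∫ x, |normalisedPressure w x| * |g x| := by simp_rw [abs_mul]
    _ ≤ Real.sqrt (∫ x, normalisedPressure w x ^ 2) * Real.sqrt (∫ x, g x ^ 2) := hCS
    _ ≤ (C_R * Real.sqrt (∫ x, ‖w x‖ ^ 4)) * (8 * (C₁ / r) * A) := by gcongr
    _ ≤ (C_R * Real.sqrt (A * Real.sqrt (∫ x, ‖θ x ^ 4 • v x‖ ^ 6))) * (8 * (C₁ / r) * A) := by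
        gcongr
    _ = _ := by ring

end DirectTerm

/-! ## Bookkeeping (Young and AM–GM) -/

section Arith

/-- The constant of the pressure-term estimate in terms of the cutoff-gradient constant `C₁`
((58)), the Sobolev constant `K` and the `L²` bound `C_R` of the singular integral. [folklore] -/
def pressureConst (C₁ K C_R : ℝ) : ℝ :=
  8 * C₁ ^ 2 + 262144 * C_R ^ 4 * C₁ ^ 4 * (K ^ 2 + 1) ^ 3 + 107584 * C₁ ^ 4 * K ^ 2 +
    8 * C₁ + 120 * C₁ ^ 3 + 1968 * C₁ ^ 3 * K

/-- The constant is nonnegative. [folklore] -/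
theorem pressureConst_nonneg {C₁ K C_R : ℝ} (hC₁ : 0 ≤ C₁) (hK : 0 ≤ K) :
    0 ≤ pressureConst C₁ K C_R := by
  unfold pressureConst
  positivity

/-- AM–GM step `A³/(r²ρ) ≤ ½ (εA²/r² + A⁴/(εr³))` (`ρ² = r`). [folklore] -/
theorem amgm_cube {A r ρ ε : ℝ} (hA : 0 ≤ A) (hρ : 0 < ρ) (hρ2 : ρ ^ 2 = r) (hε : 0 < ε) :
    A ^ 3 / (r ^ 2 * ρ) ≤ (ε * A ^ 2 / r ^ 2 + A ^ 4 / (ε * r ^ 3)) / 2 := by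
  subst hρ2
  have hP : 0 ≤ ε * A ^ 2 / (ρ ^ 2) ^ 2 := by positivity
  have hQ : 0 ≤ A ^ 4 / (ε * (ρ ^ 2) ^ 3) := by positivity
  have key : (A ^ 3 / ((ρ ^ 2) ^ 2 * ρ)) ^ 2 = (ε * A ^ 2 / (ρ ^ 2) ^ 2) * (A ^ 4 / (ε * (ρ ^ 2) ^ 3)) := by
    field_simp
  have h := sqrt_mul_le_add_half hP hQ
  rwa [← key, Real.sqrt_sq (by positivity)] at h

/-- AM–GM step `A⁴/(εr³) ≤ ½ (εA²/r² + A⁶/(ε³r⁴))`. [folklore] -/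
theorem amgm_quart {A r ε : ℝ} (hr : 0 < r) (hε : 0 < ε) :
    A ^ 4 / (ε * r ^ 3) ≤ (ε * A ^ 2 / r ^ 2 + A ^ 6 / (ε ^ 3 * r ^ 4)) / 2 := by
  have hP : 0 ≤ ε * A ^ 2 / r ^ 2 := by positivity
  have hQ : 0 ≤ A ^ 6 / (ε ^ 3 * r ^ 4) := by positivity
  have key : (A ^ 4 / (ε * r ^ 3)) ^ 2 = (ε * A ^ 2 / r ^ 2) * (A ^ 6 / (ε ^ 3 * r ^ 4)) := by
    field_simp
  have h := sqrt_mul_le_add_half hP hQ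
  rwa [← key, Real.sqrt_sq (by positivity)] at h

/-- The direct term after Young: `M √((KD)³) ≤ (ε/2)X + 8C₁² P + 262144 C_R⁴C₁⁴(K²+1)³ Q`. [folklore] -/
theorem direct_term_arith {ε X A r C₁ K C_R D T₁ : ℝ} (hε : 0 < ε)
    (hA : 0 ≤ A) (hr : 0 < r) (hC₁ : 0 ≤ C₁) (hK : 0 ≤ K)
    (hCR : 0 ≤ C_R) (hD0 : 0 ≤ D) (hD : D ^ 2 = 2 * X + 32 * (C₁ / r) ^ 2 * A ^ 2)
    (hT1 : |T₁| ≤ 8 * (C₁ / r) * A * (C_R * Real.sqrt (A * (K * D) ^ 3))) :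
    |T₁| ≤ ε / 2 * X + 8 * C₁ ^ 2 * (ε * A ^ 2 / r ^ 2) +
      262144 * C_R ^ 4 * C₁ ^ 4 * (K ^ 2 + 1) ^ 3 * (A ^ 6 / (ε ^ 3 * r ^ 4)) := by
  have hKD : 0 ≤ K * D := mul_nonneg hK hD0
  have hM0 : 0 ≤ 8 * C_R * C₁ * A * Real.sqrt A / r := by positivity
  have hη : 0 < ε / (4 * (K ^ 2 + 1)) := by positivity
  have h1 : 8 * (C₁ / r) * A * (C_R * Real.sqrt (A * (K * D) ^ 3)) =
      8 * C_R * C₁ * A * Real.sqrt A / r * Real.sqrt ((K * D) ^ 3) := by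
    rw [Real.sqrt_mul hA]
    ring
  have h2 := mul_sqrt_pow_three_le hKD hM0 hη
  have h3 : ε / (4 * (K ^ 2 + 1)) * (K * D) ^ 2 ≤ ε / 4 * D ^ 2 := by
    rw [mul_pow, div_mul_eq_mul_div, div_le_iff₀ (by positivity)]
    nlinarith [sq_nonneg D, sq_nonneg K, mul_nonneg hε.le (sq_nonneg D)]
  have h4 : ε / 4 * D ^ 2 = ε / 2 * X + 8 * C₁ ^ 2 * (ε * A ^ 2 / r ^ 2) := by
    rw [hD]
    field_simp
    ring
  have hA4 : Real.sqrt A ^ 4 = A ^ 2 := by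
    rw [show (4 : ℕ) = 2 * 2 by norm_num, pow_mul, Real.sq_sqrt hA]
  have h5 : (8 * C_R * C₁ * A * Real.sqrt A / r) ^ 4 / (ε / (4 * (K ^ 2 + 1))) ^ 3 =
      262144 * C_R ^ 4 * C₁ ^ 4 * (K ^ 2 + 1) ^ 3 * (A ^ 6 / (ε ^ 3 * r ^ 4)) := by
    have e : (8 * C_R * C₁ * A * Real.sqrt A / r) ^ 4 =
        4096 * C_R ^ 4 * C₁ ^ 4 * A ^ 4 * Real.sqrt A ^ 4 / r ^ 4 := by ring
    rw [e, hA4]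
    field_simp
    ring
  calc |T₁| ≤ 8 * (C₁ / r) * A * (C_R * Real.sqrt (A * (K * D) ^ 3)) := hT1
    _ = 8 * C_R * C₁ * A * Real.sqrt A / r * Real.sqrt ((K * D) ^ 3) := h1
    _ ≤ ε / (4 * (K ^ 2 + 1)) * (K * D) ^ 2 +
        (8 * C_R * C₁ * A * Real.sqrt A / r) ^ 4 / (ε / (4 * (K ^ 2 + 1))) ^ 3 := h2
    _ ≤ ε / 4 * D ^ 2 + (8 * C_R * C₁ * A * Real.sqrt A / r) ^ 4 / (ε / (4 * (K ^ 2 + 1))) ^ 3 := by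
        linarith
    _ = _ := by rw [h4, h5]

/-- `D ≤ 2√X + 6 C₁ A/r` from `D² = 2X + 32 (C₁/r)² A²`. [folklore] -/
theorem sqrt_dissipation_le {X A r C₁ D : ℝ} (hX : 0 ≤ X) (hA : 0 ≤ A) (hr : 0 < r)
    (hC₁ : 0 ≤ C₁) (hD0 : 0 ≤ D) (hD : D ^ 2 = 2 * X + 32 * (C₁ / r) ^ 2 * A ^ 2) :
    D ≤ 2 * Real.sqrt X + 6 * C₁ * A / r := by
  set s := Real.sqrt X with hs
  set u := C₁ * A / r with hu
  have hs0 : 0 ≤ s := Real.sqrt_nonneg X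
  have hu0 : 0 ≤ u := by positivity
  have hs2 : s ^ 2 = X := Real.sq_sqrt hX
  have h1 : (2 * s + 6 * C₁ * A / r) ^ 2 = 4 * s ^ 2 + 24 * (s * u) + 36 * u ^ 2 := by
    rw [hu]; ring
  have h2 : 32 * (C₁ / r) ^ 2 * A ^ 2 = 32 * u ^ 2 := by rw [hu]; ring
  rw [← pow_le_pow_iff_left₀ hD0 (by positivity) two_ne_zero, hD, h1, h2, hs2]
  nlinarith [mul_nonneg hs0 hu0, sq_nonneg u]

/-- The commutator term after Young and AM–GM. [folklore] -/
theorem commutator_term_arith {ε X A r ρ C₁ K D T₂ : ℝ} (hε : 0 < ε) (hX : 0 ≤ X)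
    (hA : 0 ≤ A) (hρ : 0 < ρ) (hρ2 : ρ ^ 2 = r) (hC₁ : 0 ≤ C₁) (hK : 0 ≤ K)
    (hD0 : 0 ≤ D) (hD : D ^ 2 = 2 * X + 32 * (C₁ / r) ^ 2 * A ^ 2)
    (hT2 : |T₂| ≤ 8 * (C₁ / r) * (A ^ 3 / (r * ρ) + 41 * C₁ * A ^ 2 * (K * D) * ρ / r +
      15 * C₁ ^ 2 * A ^ 3 * ρ / r ^ 2)) :
    |T₂| ≤ ε / 2 * X + 215168 * C₁ ^ 4 * K ^ 2 * (A ^ 4 / (ε * r ^ 3)) +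
      (8 * C₁ + 120 * C₁ ^ 3 + 1968 * C₁ ^ 3 * K) * (A ^ 3 / (r ^ 2 * ρ)) := by
  have hr : 0 < r := by rw [← hρ2]; positivity
  have hD' := sqrt_dissipation_le hX hA hr hC₁ hD0 hD
  have hsX := Real.sqrt_nonneg X
  -- rewrite the bound with ρ² = r
  have e1 : 8 * (C₁ / r) * (A ^ 3 / (r * ρ) + 41 * C₁ * A ^ 2 * (K * D) * ρ / r +
      15 * C₁ ^ 2 * A ^ 3 * ρ / r ^ 2) =
      (8 * C₁ + 120 * C₁ ^ 3) * (A ^ 3 / (r ^ 2 * ρ)) +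
        328 * C₁ ^ 2 * K * (A ^ 2 / (r * ρ)) * D := by
    subst hρ2
    field_simp
    ring
  have e2 : 328 * C₁ ^ 2 * K * (A ^ 2 / (r * ρ)) * D ≤
      656 * C₁ ^ 2 * K * (A ^ 2 / (r * ρ)) * Real.sqrt X +
        1968 * C₁ ^ 3 * K * (A ^ 3 / (r ^ 2 * ρ)) := by
    have h0 : 0 ≤ 328 * C₁ ^ 2 * K * (A ^ 2 / (r * ρ)) := by positivity
    have e : 328 * C₁ ^ 2 * K * (A ^ 2 / (r * ρ)) * (2 * Real.sqrt X + 6 * C₁ * A / r) =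
        656 * C₁ ^ 2 * K * (A ^ 2 / (r * ρ)) * Real.sqrt X +
          1968 * C₁ ^ 3 * K * (A ^ 3 / (r ^ 2 * ρ)) := by
      field_simp
      ring
    calc 328 * C₁ ^ 2 * K * (A ^ 2 / (r * ρ)) * D
        ≤ 328 * C₁ ^ 2 * K * (A ^ 2 / (r * ρ)) * (2 * Real.sqrt X + 6 * C₁ * A / r) :=
          mul_le_mul_of_nonneg_left hD' h0
      _ = _ := e
  -- Young
  have e3 : 656 * C₁ ^ 2 * K * (A ^ 2 / (r * ρ)) * Real.sqrt X ≤
      ε / 2 * X + 215168 * C₁ ^ 4 * K ^ 2 * (A ^ 4 / (ε * r ^ 3)) := by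
    have h := mul_le_half_mul_sq_add hε (Real.sqrt X) (656 * C₁ ^ 2 * K * (A ^ 2 / (r * ρ)))
    rw [Real.sq_sqrt hX] at h
    have h6 : (656 * C₁ ^ 2 * K * (A ^ 2 / (r * ρ))) ^ 2 / (2 * ε) =
        215168 * C₁ ^ 4 * K ^ 2 * (A ^ 4 / (ε * r ^ 3)) := by
      subst hρ2
      field_simp
      ring
    rw [h6] at h
    linarith
  linarith

/-- **Bookkeeping of the pressure term `X₅ = X₅,₁ + X₅,₂`** (Young and AM–GM; all lower-order
terms are geometric means of `εA²/r²` and `A⁶/(ε³r⁴)`). [cite: Tao2011, §8, proof of Lemma 8.1, (64)–(65)] -/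
theorem pressure_assembly_arith {ε X A r ρ C₁ K C_R D T₁ T₂ : ℝ} (hε : 0 < ε) (hX : 0 ≤ X)
    (hA : 0 ≤ A) (hρ : 0 < ρ) (hρ2 : ρ ^ 2 = r) (hC₁ : 0 ≤ C₁) (hK : 0 ≤ K)
    (hCR : 0 ≤ C_R) (hD0 : 0 ≤ D) (hD : D ^ 2 = 2 * X + 32 * (C₁ / r) ^ 2 * A ^ 2)
    (hT1 : |T₁| ≤ 8 * (C₁ / r) * A * (C_R * Real.sqrt (A * (K * D) ^ 3)))
    (hT2 : |T₂| ≤ 8 * (C₁ / r) * (A ^ 3 / (r * ρ) + 41 * C₁ * A ^ 2 * (K * D) * ρ / r +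
      15 * C₁ ^ 2 * A ^ 3 * ρ / r ^ 2)) :
    |T₁ + T₂| ≤ ε * X + pressureConst C₁ K C_R * (ε * A ^ 2 / r ^ 2 + A ^ 6 / (ε ^ 3 * r ^ 4)) := by
  have hr : 0 < r := by rw [← hρ2]; positivity
  have h1 := direct_term_arith hε hA hr hC₁ hK hCR hD0 hD hT1
  have h2 := commutator_term_arith hε hX hA hρ hρ2 hC₁ hK hD0 hD hT2
  have hcube := amgm_cube hA hρ hρ2 hε
  have hquart := amgm_quart (A := A) hr hε
  set P := ε * A ^ 2 / r ^ 2 with hP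
  set Q := A ^ 6 / (ε ^ 3 * r ^ 4) with hQ
  set W := A ^ 4 / (ε * r ^ 3) with hW
  set V := A ^ 3 / (r ^ 2 * ρ) with hV
  have hP0 : 0 ≤ P := by positivity
  have hQ0 : 0 ≤ Q := by positivity
  have hc0 : 0 ≤ 8 * C₁ + 120 * C₁ ^ 3 + 1968 * C₁ ^ 3 * K := by positivity
  have hk0 : 0 ≤ 215168 * C₁ ^ 4 * K ^ 2 := by positivity
  have hbig : 0 ≤ 262144 * C_R ^ 4 * C₁ ^ 4 * (K ^ 2 + 1) ^ 3 := by positivity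
  have h8 : 0 ≤ 8 * C₁ ^ 2 := by positivity
  have hV' : (8 * C₁ + 120 * C₁ ^ 3 + 1968 * C₁ ^ 3 * K) * V ≤
      (8 * C₁ + 120 * C₁ ^ 3 + 1968 * C₁ ^ 3 * K) * (P + Q) :=
    mul_le_mul_of_nonneg_left (by linarith) hc0
  have hW' : 215168 * C₁ ^ 4 * K ^ 2 * W ≤ 215168 * C₁ ^ 4 * K ^ 2 * ((P + Q) / 2) :=
    mul_le_mul_of_nonneg_left hquart hk0
  have hP' : 8 * C₁ ^ 2 * P ≤ 8 * C₁ ^ 2 * (P + Q) :=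
    mul_le_mul_of_nonneg_left (by linarith) h8
  have hQ' : 262144 * C_R ^ 4 * C₁ ^ 4 * (K ^ 2 + 1) ^ 3 * Q ≤
      262144 * C_R ^ 4 * C₁ ^ 4 * (K ^ 2 + 1) ^ 3 * (P + Q) :=
    mul_le_mul_of_nonneg_left (by linarith) hbig
  calc |T₁ + T₂| ≤ |T₁| + |T₂| := abs_add_le _ _
    _ ≤ ε * X + (8 * C₁ ^ 2 + 262144 * C_R ^ 4 * C₁ ^ 4 * (K ^ 2 + 1) ^ 3 +
          107584 * C₁ ^ 4 * K ^ 2 + (8 * C₁ + 120 * C₁ ^ 3 + 1968 * C₁ ^ 3 * K)) * (P + Q) := by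
        linarith
    _ = ε * X + pressureConst C₁ K C_R * (P + Q) := by
        unfold pressureConst
        ring

end Arith

/-! ## Assembly: the estimate of Tao's pressure term `X₅` -/

section Assembly

variable {R r C₁ A : ℝ} {v : ℝ³ → ℝ³}

/-- `‖θ⁶ v‖_{L⁶} ≤ K D` in `ℝ≥0∞` form, from the Sobolev step `∫|θ⁴v|⁶ ≤ (K D)⁶` (`θ¹² ≤ 1`).
[folklore] -/
theorem lintegral_taoCutoff_pow_six_rpow_le (hv : Continuous v) (hr : 0 ≤ r) (hR : 0 ≤ R)
    {B : ℝ} (hB0 : 0 ≤ B) (hB : ∫ x, ‖taoCutoff R r x ^ 4 • v x‖ ^ 6 ≤ B ^ 6) :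
    (∫⁻ x, ENNReal.ofReal (taoCutoff R r x ^ 6 * ‖v x‖) ^ (6 : ℝ)) ^ (1 / 6 : ℝ) ≤
      ENNReal.ofReal B := by
  have hint : Integrable fun x => ‖taoCutoff R r x ^ 4 • v x‖ ^ 6 := by
    have : (fun x => ‖taoCutoff R r x ^ 4 • v x‖ ^ 6) = fun x => taoCutoff R r x ^ 24 * ‖v x‖ ^ 6 := by
      funext x
      rw [norm_smul, Real.norm_eq_abs, abs_of_nonneg (taoCutoff_pow_nonneg R r x 4)]
      ring
    rw [this]
    exact integrable_taoCutoff_pow_mul (by norm_num) hr hR (hv.norm.pow 6)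
  have h1 : ∫⁻ x, ENNReal.ofReal (taoCutoff R r x ^ 6 * ‖v x‖) ^ (6 : ℝ) ≤
      ENNReal.ofReal (B ^ 6) := by
    calc ∫⁻ x, ENNReal.ofReal (taoCutoff R r x ^ 6 * ‖v x‖) ^ (6 : ℝ)
        ≤ ∫⁻ x, ENNReal.ofReal (‖taoCutoff R r x ^ 4 • v x‖ ^ 6) := by
          refine lintegral_mono fun x => ?_
          have h0 : 0 ≤ taoCutoff R r x ^ 6 * ‖v x‖ :=
            mul_nonneg (taoCutoff_pow_nonneg R r x 6) (norm_nonneg _)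
          rw [ENNReal.ofReal_rpow_of_nonneg h0 (by norm_num),
            show ((6 : ℝ)) = ((6 : ℕ) : ℝ) by norm_num, Real.rpow_natCast]
          refine ENNReal.ofReal_le_ofReal ?_
          rw [norm_smul, Real.norm_eq_abs, abs_of_nonneg (taoCutoff_pow_nonneg R r x 4)]
          have hθ0 := taoCutoff_nonneg R r x
          have hθ12 : taoCutoff R r x ^ 12 ≤ 1 := taoCutoff_pow_le_one R r x 12
          have hv0 : 0 ≤ taoCutoff R r x ^ 24 * ‖v x‖ ^ 6 := by positivity
          calc (taoCutoff R r x ^ 6 * ‖v x‖) ^ 6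
              = taoCutoff R r x ^ 12 * (taoCutoff R r x ^ 24 * ‖v x‖ ^ 6) := by ring
            _ ≤ 1 * (taoCutoff R r x ^ 24 * ‖v x‖ ^ 6) :=
                mul_le_mul_of_nonneg_right hθ12 hv0
            _ = (taoCutoff R r x ^ 4 * ‖v x‖) ^ 6 := by ring
      _ = ENNReal.ofReal (∫ x, ‖taoCutoff R r x ^ 4 • v x‖ ^ 6) :=
          (ofReal_integral_eq_lintegral_ofReal hint (ae_of_all _ fun x => by positivity)).symm
      _ ≤ ENNReal.ofReal (B ^ 6) := ENNReal.ofReal_le_ofReal hB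
  calc (∫⁻ x, ENNReal.ofReal (taoCutoff R r x ^ 6 * ‖v x‖) ^ (6 : ℝ)) ^ (1 / 6 : ℝ)
      ≤ ENNReal.ofReal (B ^ 6) ^ (1 / 6 : ℝ) := by gcongr
    _ = ENNReal.ofReal B := by
        rw [ENNReal.ofReal_rpow_of_nonneg (by positivity) (by norm_num),
          show (1 / 6 : ℝ) = ((6 : ℕ) : ℝ)⁻¹ by norm_num, Real.pow_rpow_inv_natCast hB0 (by norm_num)]

/-- **Tao 2011, §8, the estimate of the pressure term `X₅`, from the singular-integral inputs.**
`NS.tao2011_pressureTerm_estimate` holds, with the constant `pressureConst C₁ K C_R`, given the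
existence of the principal values (`NS.hasPressurePV_of_contDiff`, Stein 1970 Ch. III §1) and the
`L²` bound of the singular integral (`NS.stein1970_normalisedPressure_eLpNorm_le`, Stein 1970
Ch. II §4.2 Thm 3): split `θ⁶ p̃[v] = p̃[θ³v] + ∫ k(·,y) dy` (`commutator_eq_integral`), bound the
direct term by Cauchy–Schwarz, the `L²` bound, Hölder and Sobolev (`direct_pairing_le`) and the
commutator term by the kernel estimates (`commutator_pairing_le`), then absorb (`pressure_assembly_arith`).
[cite: Tao2011, §8, proof of Lemma 8.1, (64)–(65)] -/
theorem tao2011_pressureTerm_estimate_of_riesz (hPV : hasPressurePV_of_contDiff)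
    (hRz : stein1970_normalisedPressure_eLpNorm_le) : tao2011_pressureTerm_estimate := by
  obtain ⟨C₁, hC₁0, hC₁⟩ := exists_norm_fderiv_taoCutoff_le (E := ℝ³)
  obtain ⟨C_R, hCR0, hRz⟩ := hRz
  refine ⟨pressureConst C₁ gnsConst3 C_R, pressureConst_nonneg hC₁0.le gnsConst3_nonneg, ?_⟩
  intro v hv A hA0 hvA R r hr hrR ε hε
  have hR : 0 < R := by linarith
  have hC : ∀ x : ℝ³, ‖fderiv ℝ (taoCutoff R r) x‖ ≤ C₁ / r := hC₁ R r hr hR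
  have hCr : 0 ≤ C₁ / r := div_nonneg hC₁0.le hr.le
  have hv1 : ContDiff ℝ 1 v := hv.of_le (by exact_mod_cast le_top)
  -- the energy in real form
  have hE : ∫⁻ x, ‖v x‖ₑ ^ 2 < ⊤ := lt_of_le_of_lt hvA ENNReal.ofReal_lt_top
  have hv2 : Integrable fun x => ‖v x‖ ^ 2 :=
    integrable_sq_of_lintegral_enorm_sq_lt_top hv.continuous hE
  have hA : ∫ x, ‖v x‖ ^ 2 ≤ A ^ 2 := by
    have h := hvA
    rw [← ofReal_integral_norm_sq_eq_lintegral hv2] at h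
    exact (ENNReal.ofReal_le_ofReal_iff (sq_nonneg A)).1 h
  -- the Sobolev quantity `D = √(2X₁ + 32(C₁/r)²A²)` and `∫|θ⁴v|⁶ ≤ (K D)⁶`
  set X : ℝ := localisedDissipation (fun x => taoCutoff R r x ^ 8) v with hX
  have hX0 : 0 ≤ X := localisedDissipation_nonneg (fun x => taoCutoff_pow_nonneg R r x 8) v
  set D : ℝ := Real.sqrt (2 * X + 32 * (C₁ / r) ^ 2 * A ^ 2) with hD
  have hD0 : 0 ≤ D := Real.sqrt_nonneg _
  have hD2 : D ^ 2 = 2 * X + 32 * (C₁ / r) ^ 2 * A ^ 2 := Real.sq_sqrt (by positivity)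
  have hKD : 0 ≤ gnsConst3 * D := mul_nonneg gnsConst3_nonneg hD0
  have hI6 : ∫ x, ‖taoCutoff R r x ^ 4 • v x‖ ^ 6 ≤ (gnsConst3 * D) ^ 6 :=
    integral_norm_taoCutoff_pow_four_smul_pow_six_le hv1 hv2 hA hr hR hC hC₁0.le
  -- the two terms
  obtain ⟨hT1i, hT1⟩ := direct_pairing_le hCR0 hRz hv hv2 hA hA0 hr hR hC hC₁0.le
  obtain ⟨hT2i, hT2⟩ := commutator_pairing_le hv.continuous hr hC hC₁0.le hA0 hKD hvA
    (lintegral_taoCutoff_pow_six_rpow_le hv.continuous hr.le hR.le hKD hI6)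
  -- the splitting `p̃[v] D(θ⁸)(v) = p̃[θ³v] g + (∫k) g`
  have hsplit : (fun x => normalisedPressure v x * fderiv ℝ (fun y => taoCutoff R r y ^ 8) x (v x)) =
      fun x => normalisedPressure (fun y => taoCutoff R r y ^ 3 • v y) x *
          (8 * taoCutoff R r x * fderiv ℝ (taoCutoff R r) x (v x)) +
        (∫ y, commKernel R r v x y) * (8 * taoCutoff R r x * fderiv ℝ (taoCutoff R r) x (v x)) := by
    funext x
    have hc := commutator_eq_integral hPV hv1 hE hv2 hr hC hCr x
    rw [fderiv_taoCutoff_pow_eight_apply, ← add_mul, ← hc]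
    ring
  rw [hsplit, integral_add hT1i hT2i]
  -- massage `hT1`: `√(∫|θ⁴v|⁶) ≤ (K D)³`
  have hT1' : |∫ x, normalisedPressure (fun y => taoCutoff R r y ^ 3 • v y) x *
      (8 * taoCutoff R r x * fderiv ℝ (taoCutoff R r) x (v x))| ≤
      8 * (C₁ / r) * A * (C_R * Real.sqrt (A * (gnsConst3 * D) ^ 3)) := by
    refine hT1.trans ?_
    have h6 : Real.sqrt (∫ x, ‖taoCutoff R r x ^ 4 • v x‖ ^ 6) ≤ (gnsConst3 * D) ^ 3 := by
      calc Real.sqrt (∫ x, ‖taoCutoff R r x ^ 4 • v x‖ ^ 6)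
          ≤ Real.sqrt (((gnsConst3 * D) ^ 3) ^ 2) := Real.sqrt_le_sqrt (by rw [← pow_mul]; exact hI6)
        _ = (gnsConst3 * D) ^ 3 := Real.sqrt_sq (by positivity)
    gcongr
  exact pressure_assembly_arith hε hX0 hA0 (Real.sqrt_pos.2 hr) (Real.sq_sqrt hr.le) hC₁0.le
    gnsConst3_nonneg hCR0 hD0 hD2 hT1' hT2

/-- **Tao 2011, Lemma 8.1, reduced to three classical inputs.** The energy bound for finite
energy smooth solutions (`NS.tao_finite_energy_smooth_energy_bound`) follows from Tao's pressure
normalisation (Lemma 4.1 (i), `NS.tao_pressure_normalisation`), the existence of the principal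
values of the Riesz-type singular integral (`NS.hasPressurePV_of_contDiff`, Stein 1970 III §1)
and its `L²` boundedness (`NS.stein1970_normalisedPressure_eLpNorm_le`, Stein 1970 II §4.2
Thm 3); everything else in §8 of the paper is proved in layers 1–3.
[cite: Tao2011, Lemma 8.1] -/
theorem tao_finite_energy_smooth_energy_bound_of_riesz (hP : tao_pressure_normalisation)
    (hPV : hasPressurePV_of_contDiff) (hRz : stein1970_normalisedPressure_eLpNorm_le) :
    tao_finite_energy_smooth_energy_bound :=
  tao_finite_energy_smooth_energy_bound_of_pressure hP (tao2011_pressureTerm_estimate_of_riesz hPV hRz)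

end Assembly

end Literature.Analysis.FluidPDE
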